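import Literature.Analysis.FluidPDE.JiaSverak2014PerturbationSliced
import Literature.Analysis.FluidPDE.JiaSverak2014PressurePairingLocal
import Literature.Analysis.FluidPDE.JiaSverak2014CubicLocal
import Literature.Analysis.FluidPDE.WeakSpatialGradientSum
import Literature.Analysis.FluidPDE.LocalLerayDifferenceEnergy
import HarnessLib

/-!
# Jia–Šverák 2014, proof of Thm. 3.1: one step of the decay iteration for the local energy of
  the perturbation

Analysis/FluidPDE proofs file (theorems only, no new definitions, no new named facts), part of
the proof of the named fact `Literature.Analysis.FluidPDE.jia_sverak_2014_theorem_3_2`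
(`JiaSverak2014LocalRegularity.lean`; H. Jia, V. Šverák, Invent. Math. 196 (2014) =
arXiv:1204.0529, §3 Thm. 3.2). The printed proof of Thm. 3.1 (arXiv p. 8) bounds the local
energy of `v = u - a` near `x₀` from the local energy inequality for `v` from the initial time:
"`∫_{B_{4/3}} |v|²φ(x,t) + ∫₀ᵗ∫ |∇v|²φ ≤ ∫₀ᵗ∫ |v|²(Δφ + (u·∇)φ) + 2qv·∇φ - 2v·(v·∇)a φ`
… By well-known interpolation inequalities … `≤ C(α,m,M) t^{1/10}`". We iterate a quantitative
form of this step on shrinking balls `B_r(y) ⊃ B_{r/2}(y) ⊃ supp ψ`: if on `(0,t) × B_r(y)` the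
energy of `v` is a.e. `≤ E` and the dissipation is `≤ E`, then against a cut-off `ψ` supported in
`B_{r/2}(y)`,

  `∫ |v(s)|²ψ + 2∫₀ˢ∫ |∇v|²ψ ≤ C [(1 + A + C₁A) √t E + t^{1/4} E^{3/2} + (A α + α²) t E^{1/2}]`

for a.e. `s ∈ (0,t)` (`α²` a bound of the uniformly local energy of `v`, `|a| ≤ 2A`,
`√t|∇a| ≤ C₁A`), with `C` depending only on `r` and on the bounds of `ψ, ∇ψ, Δψ`. The four flux
terms: `|v|²Δψ ≤ C t E`; `|v|² u·∇ψ ≤ 2A t E + ∫∫|v|³` with the cubic interpolation on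
`(0,t) × B_r(y)` (`exists_lintegral_cube_cylinder_le_ball`); `ψ⟪Da v, v⟫ ≤ C₁A ∫₀ᵗ s^{-1/2} E ds`;
and the pressure pairing `∫(p - p_K)⟨v, ∇ψ⟩` slice by slice through the local expansions of both
pressures at `(y, r/2)` (`slice_pressure_pairing_le_local`: near field by the bilinear
Calderón–Zygmund bound, far field by the uniformly local tails, gauges by `div v = 0`).

* `flux_pieces_integrableOn` — integrability of the four flux densities on the strip;
* `ae_good_slice_pair` — the a.e. slice data of the pair `(a, u)` consumed by the slice estimate;
* `energy_step` — the step estimate above.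

## References

* H. Jia, V. Šverák, Invent. Math. 196 (2014) = arXiv:1204.0529, §3, proof of Thm. 3.1 (p. 8).
  Bib key `JiaSverak2014`.
* P. G. Lemarié-Rieusset, *The Navier–Stokes Problem in the 21st Century* (2016), Prop. 14.1,
  Thm. 14.7 (proof pp. 515–518). Bib key `LemarieRieusset2016`.
* K. Kang, H. Miura, T.-P. Tsai, IMRN 2021 = arXiv:1812.10509, Lemma 3.4. Bib key
  `KangMiuraTsai2020`.
-/

noncomputable section

open MeasureTheory TopologicalSpace Set Function Filter Metric
open _root_.Topology
open scoped ENNReal NNReal RealInnerProductSpace Laplacian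

namespace Literature.Analysis.FluidPDE

namespace JiaSverak2014

/-! ### Elementary inequalities -/

/-- `(a + b)³ ≤ 4 (a³ + b³)` for `a, b ≥ 0`. [folklore] -/
private theorem add_pow_three_le' {a b : ℝ} (ha : 0 ≤ a) (hb : 0 ≤ b) : (a + b) ^ 3 ≤ 4 * (a ^ 3 + b ^ 3) := by
  nlinarith [sq_nonneg (a - b), mul_nonneg ha hb, sq_nonneg (a + b)]

/-! ### Integrability of the flux densities on the strip -/

set_option maxHeartbeats 1600000 in
/-- **The four flux densities of the perturbed local energy inequality are integrable on the
strip** `(0, min(T',S₀)) × ℝ³` (and the energy density too): `|v|²ψ`, `|v|²Δψ`, `|v|² u·∇ψ`,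
`(p - p_K) v·∇ψ`, `ψ⟪Da v, v⟫` for a smooth compactly supported `ψ` (the bookkeeping of
`ae_perturbed_energy_slice`: `u ∈ L² ∩ L³`, `p, p_K ∈ L^{3/2}` on the boxes of the classes,
`|a| ≤ 2A`, `|∇a| ≤ C₁A t^{-1/2}` against the uniformly local energy). [folklore] -/
theorem flux_pieces_integrableOn {T' S₀ S₂ A C₁ : ℝ}
    {u₀ a₀ : (EuclideanSpace ℝ (Fin 3)) → (EuclideanSpace ℝ (Fin 3))} {u a : ℝ → (EuclideanSpace ℝ (Fin 3)) → (EuclideanSpace ℝ (Fin 3))}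
    {p π pK : ℝ → (EuclideanSpace ℝ (Fin 3)) → ℝ} {ψ : (EuclideanSpace ℝ (Fin 3)) → ℝ}
    (hT' : 0 < T') (hu : IsLocalLeraySolutionOn T' 1 u₀ u p)
    (hS₀ : 0 < S₀) (hS₀₂ : S₀ ≤ S₂) (hA : 0 < A) (hC₁ : 0 ≤ C₁)
    (hLK : IsLocalLeraySolutionOn S₀ 1 a₀ a pK) (hcl : IsClassicalNSSolutionOn (Ioo 0 S₂) 1 0 a π)
    (hbd : ∀ t ∈ Ioo 0 S₂, ∀ x, ‖a t x‖ ≤ 2 * A)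
    (hgrad : ∀ t ∈ Ioo 0 S₀, ∀ x, Real.sqrt t * ‖fderiv ℝ (a t) x‖ ≤ C₁ * A)
    (hψ : ContDiff ℝ (⊤ : ℕ∞) ψ) (hψc : HasCompactSupport ψ) :
    IntegrableOn (fun z : ℝ × (EuclideanSpace ℝ (Fin 3)) => ‖u z.1 z.2 - a z.1 z.2‖ ^ 2 * ψ z.2)
        (Ioo 0 (min T' S₀) ×ˢ (univ : Set (EuclideanSpace ℝ (Fin 3)))) volume ∧
      IntegrableOn (fun z : ℝ × (EuclideanSpace ℝ (Fin 3)) => ‖u z.1 z.2 - a z.1 z.2‖ ^ 2 * (Δ ψ) z.2)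
        (Ioo 0 (min T' S₀) ×ˢ (univ : Set (EuclideanSpace ℝ (Fin 3)))) volume ∧
      IntegrableOn (fun z : ℝ × (EuclideanSpace ℝ (Fin 3)) => ‖u z.1 z.2 - a z.1 z.2‖ ^ 2 * ⟪u z.1 z.2, gradient ψ z.2⟫)
        (Ioo 0 (min T' S₀) ×ˢ (univ : Set (EuclideanSpace ℝ (Fin 3)))) volume ∧
      IntegrableOn (fun z : ℝ × (EuclideanSpace ℝ (Fin 3)) =>
          (p z.1 z.2 - pK z.1 z.2) * ⟪u z.1 z.2 - a z.1 z.2, gradient ψ z.2⟫)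
        (Ioo 0 (min T' S₀) ×ˢ (univ : Set (EuclideanSpace ℝ (Fin 3)))) volume ∧
      IntegrableOn (fun z : ℝ × (EuclideanSpace ℝ (Fin 3)) =>
          ψ z.2 * ⟪fderiv ℝ (a z.1) z.2 (u z.1 z.2 - a z.1 z.2), u z.1 z.2 - a z.1 z.2⟫)
        (Ioo 0 (min T' S₀) ×ˢ (univ : Set (EuclideanSpace ℝ (Fin 3)))) volume := by
  set S : ℝ := min T' S₀ with hSdef
  have hS : 0 < S := lt_min hT' hS₀
  have hST' : S ≤ T' := min_le_left _ _
  have hSS₀ : S ≤ S₀ := min_le_right _ _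
  have hSS₂ : S ≤ S₂ := hSS₀.trans hS₀₂
  -- ## the cut-off `ψ`
  set Kψ : Set (EuclideanSpace ℝ (Fin 3)) := tsupport ψ with hKψ
  have hKc : IsCompact Kψ := hψc
  obtain ⟨ρ₀, hρ₀⟩ := hKc.isBounded.subset_closedBall (0 : EuclideanSpace ℝ (Fin 3))
  set ρ : ℝ := max ρ₀ 1 with hρdef
  have hρ : 0 < ρ := lt_of_lt_of_le one_pos (le_max_right _ _)
  have hK2' : Kψ ⊆ closedBall (0 : EuclideanSpace ℝ (Fin 3)) ρ := hρ₀.trans (closedBall_subset_closedBall (le_max_left _ _))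
  have hK2 : Kψ ⊆ ball (0 : EuclideanSpace ℝ (Fin 3)) (2 * ρ) := hK2'.trans (closedBall_subset_ball (by linarith))
  have hψK : ∀ x ∉ Kψ, ψ x = 0 := fun x hx => image_eq_zero_of_notMem_tsupport hx
  have hgK : ∀ x ∉ Kψ, gradient ψ x = 0 := fun x hx => by
    have h0 : ψ =ᶠ[𝓝 x] fun _ => (0 : ℝ) := notMem_tsupport_iff_eventuallyEq.1 hx
    rw [gradient, h0.fderiv_eq, fderiv_fun_const, Pi.zero_apply, map_zero]
  have hLK0 : ∀ x ∉ Kψ, (Δ ψ) x = 0 := fun x hx => laplacian_eq_zero_of_notMem_tsupport hx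
  have hψcont : Continuous ψ := hψ.continuous
  have hgcont : Continuous fun x => gradient ψ x :=
    (InnerProductSpace.toDual ℝ (EuclideanSpace ℝ (Fin 3))).symm.continuous.comp (hψ.continuous_fderiv (by simp))
  have hLcont : Continuous fun x => (Δ ψ) x := continuous_laplacian (hψ.of_le (by norm_cast))
  have hgcs : HasCompactSupport fun x => gradient ψ x := by
    refine HasCompactSupport.intro hKc fun x hx => hgK x hx
  have hLcs : HasCompactSupport fun x => (Δ ψ) x := HasCompactSupport.intro hKc fun x hx => hLK0 x hx
  obtain ⟨Cψ, hCψ⟩ := hψcont.bounded_above_of_compact_support hψc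
  obtain ⟨Cg, hCg⟩ := hgcont.bounded_above_of_compact_support hgcs
  obtain ⟨CL, hCL⟩ := hLcont.bounded_above_of_compact_support hLcs
  have hCψ0 : 0 ≤ Cψ := (norm_nonneg _).trans (hCψ 0)
  have hCg0 : 0 ≤ Cg := (norm_nonneg _).trans (hCg 0)
  have hCL0 : 0 ≤ CL := (norm_nonneg _).trans (hCL 0)
  have hψle : ∀ x, ‖ψ x‖ ≤ Cψ := hCψ
  -- ## the box `B = (0,S) × Kψ` and measurability
  set I : Set ℝ := Ioo 0 S with hI
  set B : Set (ℝ × (EuclideanSpace ℝ (Fin 3))) := I ×ˢ Kψ with hB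
  have hBm : MeasurableSet B := measurableSet_Ioo.prod hKc.measurableSet
  have hIT' : I ⊆ Ioo 0 T' := Ioo_subset_Ioo_right hST'
  have hIS₀ : I ⊆ Ioo 0 S₀ := Ioo_subset_Ioo_right hSS₀
  have hIS₂ : I ⊆ Ioo 0 S₂ := Ioo_subset_Ioo_right hSS₂
  have hBT' : B ⊆ Ioo 0 T' ×ˢ ball (0 : EuclideanSpace ℝ (Fin 3)) (2 * ρ) := Set.prod_mono hIT' hK2
  have hBT'c : B ⊆ Ioo 0 T' ×ˢ closedBall (0 : EuclideanSpace ℝ (Fin 3)) ρ := Set.prod_mono hIT' hK2'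
  have hBS₀c : B ⊆ Ioo 0 S₀ ×ˢ closedBall (0 : EuclideanSpace ℝ (Fin 3)) ρ := Set.prod_mono hIS₀ hK2'
  have hBvol : volume B < ∞ :=
    (measure_mono (Set.prod_mono Ioo_subset_Icc_self Subset.rfl)).trans_lt
      ((isCompact_Icc.prod hKc).measure_lt_top)
  haveI : IsFiniteMeasure (volume.restrict B) := ⟨by rwa [Measure.restrict_apply_univ]⟩
  have hmemB : ∀ᵐ z ∂(volume.restrict B), z ∈ B := ae_restrict_mem hBm
  -- measurability of the fields on the strip `(0,S) × ℝ³` and on `B`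
  have hstripm : MeasurableSet (I ×ˢ (univ : Set (EuclideanSpace ℝ (Fin 3)))) := measurableSet_Ioo.prod MeasurableSet.univ
  have hum : AEStronglyMeasurable (uncurry u) (volume.restrict (I ×ˢ (univ : Set (EuclideanSpace ℝ (Fin 3))))) :=
    hu.aestronglyMeasurable.mono_measure (Measure.restrict_mono (Set.prod_mono hIT' Subset.rfl) le_rfl)
  have hacont : ContinuousOn (uncurry a) (Ioo 0 S₂ ×ˢ (univ : Set (EuclideanSpace ℝ (Fin 3)))) := hcl.smooth_velocity.continuousOn
  have ham : AEStronglyMeasurable (uncurry a) (volume.restrict (I ×ˢ (univ : Set (EuclideanSpace ℝ (Fin 3))))) :=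
    (hacont.mono (Set.prod_mono hIS₂ Subset.rfl)).aestronglyMeasurable hstripm
  have hDacont : ContinuousOn (fun z : ℝ × (EuclideanSpace ℝ (Fin 3)) => fderiv ℝ (a z.1) z.2) (Ioo 0 S₂ ×ˢ (univ : Set (EuclideanSpace ℝ (Fin 3)))) :=
    (hcl.smooth_velocity.fderiv_slice isOpen_Ioo.uniqueDiffOn).continuousOn
  have hDam : AEStronglyMeasurable (fun z : ℝ × (EuclideanSpace ℝ (Fin 3)) => fderiv ℝ (a z.1) z.2) (volume.restrict (I ×ˢ (univ : Set (EuclideanSpace ℝ (Fin 3))))) :=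
    (hDacont.mono (Set.prod_mono hIS₂ Subset.rfl)).aestronglyMeasurable hstripm
  have hpm : AEStronglyMeasurable (uncurry p) (volume.restrict (I ×ˢ (univ : Set (EuclideanSpace ℝ (Fin 3))))) :=
    hu.aestronglyMeasurable_pressure.mono_measure (Measure.restrict_mono (Set.prod_mono hIT' Subset.rfl) le_rfl)
  have hpKm : AEStronglyMeasurable (uncurry pK) (volume.restrict (I ×ˢ (univ : Set (EuclideanSpace ℝ (Fin 3))))) :=
    hLK.aestronglyMeasurable_pressure.mono_measure (Measure.restrict_mono (Set.prod_mono hIS₀ Subset.rfl) le_rfl)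
  have hψm2 : AEStronglyMeasurable (fun z : ℝ × (EuclideanSpace ℝ (Fin 3)) => ψ z.2) (volume.restrict (I ×ˢ (univ : Set (EuclideanSpace ℝ (Fin 3))))) :=
    (hψcont.comp continuous_snd).aestronglyMeasurable
  have hgm2 : AEStronglyMeasurable (fun z : ℝ × (EuclideanSpace ℝ (Fin 3)) => gradient ψ z.2) (volume.restrict (I ×ˢ (univ : Set (EuclideanSpace ℝ (Fin 3))))) :=
    (hgcont.comp continuous_snd).aestronglyMeasurable
  have hLm2 : AEStronglyMeasurable (fun z : ℝ × (EuclideanSpace ℝ (Fin 3)) => (Δ ψ) z.2) (volume.restrict (I ×ˢ (univ : Set (EuclideanSpace ℝ (Fin 3))))) :=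
    (hLcont.comp continuous_snd).aestronglyMeasurable
  have hresB : volume.restrict B ≤ volume.restrict (I ×ˢ (univ : Set (EuclideanSpace ℝ (Fin 3)))) :=
    Measure.restrict_mono (Set.prod_mono Subset.rfl (subset_univ _)) le_rfl
  -- ## pointwise bounds on `B`
  have hvsq : ∀ z ∈ B, ‖u z.1 z.2 - a z.1 z.2‖ ^ 2 ≤ 2 * ‖u z.1 z.2‖ ^ 2 + 8 * A ^ 2 := by
    intro z hz
    have ha := hbd z.1 (hIS₂ hz.1) z.2
    have h1 : ‖u z.1 z.2 - a z.1 z.2‖ ≤ ‖u z.1 z.2‖ + 2 * A := (norm_sub_le _ _).trans (by linarith)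
    have h2 : ‖u z.1 z.2 - a z.1 z.2‖ ^ 2 ≤ (‖u z.1 z.2‖ + 2 * A) ^ 2 := pow_le_pow_left₀ (norm_nonneg _) h1 2
    nlinarith [h2, sq_nonneg (‖u z.1 z.2‖ - 2 * A)]
  have hvcube : ∀ z ∈ B, ‖u z.1 z.2 - a z.1 z.2‖ ^ 3 ≤ 4 * (‖u z.1 z.2‖ ^ 3 + 8 * A ^ 3) := by
    intro z hz
    have ha := hbd z.1 (hIS₂ hz.1) z.2
    have h1 : ‖u z.1 z.2 - a z.1 z.2‖ ≤ ‖u z.1 z.2‖ + 2 * A := (norm_sub_le _ _).trans (by linarith)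
    calc ‖u z.1 z.2 - a z.1 z.2‖ ^ 3 ≤ (‖u z.1 z.2‖ + 2 * A) ^ 3 :=
          pow_le_pow_left₀ (norm_nonneg _) h1 3
      _ ≤ 4 * (‖u z.1 z.2‖ ^ 3 + (2 * A) ^ 3) := add_pow_three_le' (norm_nonneg _) (by linarith)
      _ = 4 * (‖u z.1 z.2‖ ^ 3 + 8 * A ^ 3) := by ring
  -- ## integrability of `|u|²`, `|u|³`, `|p|^{3/2}`, `|p_K|^{3/2}` on `B`
  have hu2B : Integrable (fun z : ℝ × (EuclideanSpace ℝ (Fin 3)) => ‖u z.1 z.2‖ ^ 2) (volume.restrict B) := by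
    refine ⟨(hum.mono_measure hresB).norm.pow 2, ?_⟩
    show ∫⁻ z, ‖‖u z.1 z.2‖ ^ 2‖ₑ ∂(volume.restrict B) < ∞
    have e : ∀ z : ℝ × (EuclideanSpace ℝ (Fin 3)), ‖‖u z.1 z.2‖ ^ 2‖ₑ = ‖u z.1 z.2‖ₑ ^ 2 := fun z => by
      rw [Real.enorm_eq_ofReal (sq_nonneg _), ENNReal.ofReal_pow (norm_nonneg _), ofReal_norm]
    simp_rw [e]
    exact (lintegral_mono_set hBT'c).trans_lt (hu.sqIntegrable _ (isCompact_closedBall _ _))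
  have hu3B : Integrable (fun z : ℝ × (EuclideanSpace ℝ (Fin 3)) => ‖u z.1 z.2‖ ^ 3) (volume.restrict B) := by
    refine ⟨(hum.mono_measure hresB).norm.pow 3, ?_⟩
    show ∫⁻ z, ‖‖u z.1 z.2‖ ^ 3‖ₑ ∂(volume.restrict B) < ∞
    have e : ∀ z : ℝ × (EuclideanSpace ℝ (Fin 3)), ‖‖u z.1 z.2‖ ^ 3‖ₑ = ‖u z.1 z.2‖ₑ ^ (3 : ℕ) := fun z => by
      rw [Real.enorm_eq_ofReal (pow_nonneg (norm_nonneg _) _), ENNReal.ofReal_pow (norm_nonneg _), ofReal_norm]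
    simp_rw [e]
    exact (lintegral_mono_set hBT').trans_lt (hu.lintegral_cube_box_lt_top 0 (2 * ρ))
  have hp32B : Integrable (fun z : ℝ × (EuclideanSpace ℝ (Fin 3)) => |p z.1 z.2| ^ (3 / 2 : ℝ)) (volume.restrict B) := by
    refine ⟨((hpm.mono_measure hresB).norm.aemeasurable.pow_const (3 / 2 : ℝ)).aestronglyMeasurable.congr
      (Eventually.of_forall fun z => by simp only [Real.norm_eq_abs]; rfl), ?_⟩
    show ∫⁻ z, ‖|p z.1 z.2| ^ (3 / 2 : ℝ)‖ₑ ∂(volume.restrict B) < ∞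
    have e : ∀ z : ℝ × (EuclideanSpace ℝ (Fin 3)), ‖|p z.1 z.2| ^ (3 / 2 : ℝ)‖ₑ = ‖p z.1 z.2‖ₑ ^ (3 / 2 : ℝ) := fun z => by
      rw [Real.enorm_eq_ofReal (Real.rpow_nonneg (abs_nonneg _) _), ← Real.norm_eq_abs,
        ← ENNReal.ofReal_rpow_of_nonneg (norm_nonneg _) (by norm_num), ofReal_norm]
    simp_rw [e]
    exact (lintegral_mono_set hBT'c).trans_lt (hu.pressure _ (isCompact_closedBall _ _))
  have hpK32B : Integrable (fun z : ℝ × (EuclideanSpace ℝ (Fin 3)) => |pK z.1 z.2| ^ (3 / 2 : ℝ)) (volume.restrict B) := by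
    refine ⟨((hpKm.mono_measure hresB).norm.aemeasurable.pow_const (3 / 2 : ℝ)).aestronglyMeasurable.congr
      (Eventually.of_forall fun z => by simp only [Real.norm_eq_abs]; rfl), ?_⟩
    show ∫⁻ z, ‖|pK z.1 z.2| ^ (3 / 2 : ℝ)‖ₑ ∂(volume.restrict B) < ∞
    have e : ∀ z : ℝ × (EuclideanSpace ℝ (Fin 3)), ‖|pK z.1 z.2| ^ (3 / 2 : ℝ)‖ₑ = ‖pK z.1 z.2‖ₑ ^ (3 / 2 : ℝ) := fun z => by
      rw [Real.enorm_eq_ofReal (Real.rpow_nonneg (abs_nonneg _) _), ← Real.norm_eq_abs,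
        ← ENNReal.ofReal_rpow_of_nonneg (norm_nonneg _) (by norm_num), ofReal_norm]
    simp_rw [e]
    exact (lintegral_mono_set hBS₀c).trans_lt (hLK.pressure _ (isCompact_closedBall _ _))
  -- ## the densities
  set W : ℝ × (EuclideanSpace ℝ (Fin 3)) → ℝ := fun z => ‖u z.1 z.2 - a z.1 z.2‖ ^ 2 * ψ z.2 with hW
  set R₁ : ℝ × (EuclideanSpace ℝ (Fin 3)) → ℝ := fun z => ‖u z.1 z.2 - a z.1 z.2‖ ^ 2 * (Δ ψ) z.2 with hR₁
  set R₂ : ℝ × (EuclideanSpace ℝ (Fin 3)) → ℝ := fun z => ‖u z.1 z.2 - a z.1 z.2‖ ^ 2 * ⟪u z.1 z.2, gradient ψ z.2⟫ with hR₂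
  set R₃ : ℝ × (EuclideanSpace ℝ (Fin 3)) → ℝ := fun z => (p z.1 z.2 - pK z.1 z.2) * ⟪u z.1 z.2 - a z.1 z.2, gradient ψ z.2⟫ with hR₃
  set R₄ : ℝ × (EuclideanSpace ℝ (Fin 3)) → ℝ := fun z => ψ z.2 * ⟪fderiv ℝ (a z.1) z.2 (u z.1 z.2 - a z.1 z.2), u z.1 z.2 - a z.1 z.2⟫ with hR₄
  have hvm : AEStronglyMeasurable (fun z : ℝ × (EuclideanSpace ℝ (Fin 3)) => u z.1 z.2 - a z.1 z.2) (volume.restrict (I ×ˢ (univ : Set (EuclideanSpace ℝ (Fin 3))))) :=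
    hum.sub ham
  have hWm : AEStronglyMeasurable W (volume.restrict (I ×ˢ (univ : Set (EuclideanSpace ℝ (Fin 3))))) := (hvm.norm.pow 2).mul hψm2
  have hR₁m : AEStronglyMeasurable R₁ (volume.restrict (I ×ˢ (univ : Set (EuclideanSpace ℝ (Fin 3))))) := (hvm.norm.pow 2).mul hLm2
  have hR₂m : AEStronglyMeasurable R₂ (volume.restrict (I ×ˢ (univ : Set (EuclideanSpace ℝ (Fin 3))))) := (hvm.norm.pow 2).mul (hum.inner hgm2)
  have hR₃m : AEStronglyMeasurable R₃ (volume.restrict (I ×ˢ (univ : Set (EuclideanSpace ℝ (Fin 3))))) := (hpm.sub hpKm).mul (hvm.inner hgm2)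
  have happ : AEStronglyMeasurable (fun z : ℝ × (EuclideanSpace ℝ (Fin 3)) => fderiv ℝ (a z.1) z.2 (u z.1 z.2 - a z.1 z.2))
      (volume.restrict (I ×ˢ (univ : Set (EuclideanSpace ℝ (Fin 3))))) :=
    isBoundedBilinearMap_apply.continuous.comp_aestronglyMeasurable (hDam.prodMk hvm)
  have hR₄m : AEStronglyMeasurable R₄ (volume.restrict (I ×ˢ (univ : Set (EuclideanSpace ℝ (Fin 3))))) :=
    hψm2.mul (happ.inner hvm)
  -- ## integrability of `W`, `R₁`, `R₂`, `R₃` on `B`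
  have hWB : Integrable W (volume.restrict B) := by
    have hg : Integrable (fun z : ℝ × (EuclideanSpace ℝ (Fin 3)) => Cψ * (2 * ‖u z.1 z.2‖ ^ 2 + 8 * A ^ 2)) (volume.restrict B) :=
      ((hu2B.const_mul 2).add (integrable_const _)).const_mul Cψ
    refine Integrable.mono' hg (hWm.mono_measure hresB) ?_
    filter_upwards [hmemB] with z hz
    rw [hW, norm_mul, Real.norm_eq_abs, abs_of_nonneg (sq_nonneg _)]
    calc ‖u z.1 z.2 - a z.1 z.2‖ ^ 2 * ‖ψ z.2‖ ≤ (2 * ‖u z.1 z.2‖ ^ 2 + 8 * A ^ 2) * Cψ :=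
          mul_le_mul (hvsq z hz) (hψle _) (norm_nonneg _) (by positivity)
      _ = Cψ * (2 * ‖u z.1 z.2‖ ^ 2 + 8 * A ^ 2) := mul_comm _ _
  have hR₁B : Integrable R₁ (volume.restrict B) := by
    have hg : Integrable (fun z : ℝ × (EuclideanSpace ℝ (Fin 3)) => CL * (2 * ‖u z.1 z.2‖ ^ 2 + 8 * A ^ 2)) (volume.restrict B) :=
      ((hu2B.const_mul 2).add (integrable_const _)).const_mul CL
    refine Integrable.mono' hg (hR₁m.mono_measure hresB) ?_
    filter_upwards [hmemB] with z hz
    rw [hR₁, norm_mul, Real.norm_eq_abs, abs_of_nonneg (sq_nonneg _)]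
    calc ‖u z.1 z.2 - a z.1 z.2‖ ^ 2 * ‖(Δ ψ) z.2‖ ≤ (2 * ‖u z.1 z.2‖ ^ 2 + 8 * A ^ 2) * CL :=
          mul_le_mul (hvsq z hz) (hCL _) (norm_nonneg _) (by positivity)
      _ = CL * (2 * ‖u z.1 z.2‖ ^ 2 + 8 * A ^ 2) := mul_comm _ _
  have hnorm_le_cube : ∀ r : ℝ, 0 ≤ r → r ≤ 1 + r ^ 3 := fun r hr => by nlinarith [sq_nonneg (r - 1), sq_nonneg r]
  have hR₂B : Integrable R₂ (volume.restrict B) := by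
    have hg : Integrable (fun z : ℝ × (EuclideanSpace ℝ (Fin 3)) => Cg * (2 * ‖u z.1 z.2‖ ^ 3 + 8 * A ^ 2 * (1 + ‖u z.1 z.2‖ ^ 3)))
        (volume.restrict B) :=
      ((hu3B.const_mul 2).add (((integrable_const (1 : ℝ)).add hu3B).const_mul _)).const_mul Cg
    refine Integrable.mono' hg (hR₂m.mono_measure hresB) ?_
    filter_upwards [hmemB] with z hz
    rw [hR₂, norm_mul, Real.norm_eq_abs, abs_of_nonneg (sq_nonneg _)]
    have h1 : ‖⟪u z.1 z.2, gradient ψ z.2⟫‖ ≤ ‖u z.1 z.2‖ * Cg :=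
      (norm_inner_le_norm _ _).trans (mul_le_mul_of_nonneg_left (hCg _) (norm_nonneg _))
    have hu0 := norm_nonneg (u z.1 z.2)
    calc ‖u z.1 z.2 - a z.1 z.2‖ ^ 2 * ‖⟪u z.1 z.2, gradient ψ z.2⟫‖
        ≤ (2 * ‖u z.1 z.2‖ ^ 2 + 8 * A ^ 2) * (‖u z.1 z.2‖ * Cg) :=
          mul_le_mul (hvsq z hz) h1 (norm_nonneg _) (by positivity)
      _ = Cg * (2 * ‖u z.1 z.2‖ ^ 3 + 8 * A ^ 2 * ‖u z.1 z.2‖) := by ring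
      _ ≤ Cg * (2 * ‖u z.1 z.2‖ ^ 3 + 8 * A ^ 2 * (1 + ‖u z.1 z.2‖ ^ 3)) := by
          gcongr
          exact hnorm_le_cube _ hu0
  have hR₃B : Integrable R₃ (volume.restrict B) := by
    have hg : Integrable (fun z : ℝ × (EuclideanSpace ℝ (Fin 3)) => Cg * ((2 / 3) * (|p z.1 z.2| ^ (3 / 2 : ℝ) + |pK z.1 z.2| ^ (3 / 2 : ℝ)) +
        (2 / 3) * (4 * (‖u z.1 z.2‖ ^ 3 + 8 * A ^ 3)))) (volume.restrict B) :=
      (((hp32B.add hpK32B).const_mul _).add (((hu3B.add (integrable_const _)).const_mul 4).const_mul _)).const_mul Cg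
    refine Integrable.mono' hg (hR₃m.mono_measure hresB) ?_
    filter_upwards [hmemB] with z hz
    rw [hR₃, norm_mul, Real.norm_eq_abs]
    have h1 : ‖⟪u z.1 z.2 - a z.1 z.2, gradient ψ z.2⟫‖ ≤ ‖u z.1 z.2 - a z.1 z.2‖ * Cg :=
      (norm_inner_le_norm _ _).trans (mul_le_mul_of_nonneg_left (hCg _) (norm_nonneg _))
    have hv0 := norm_nonneg (u z.1 z.2 - a z.1 z.2)
    have hY₁ := mul_le_rpow_threeHalves_add_cube (|p z.1 z.2|) hv0
    have hY₂ := mul_le_rpow_threeHalves_add_cube (|pK z.1 z.2|) hv0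
    rw [abs_abs] at hY₁ hY₂
    have hc3 := hvcube z hz
    calc |p z.1 z.2 - pK z.1 z.2| * ‖⟪u z.1 z.2 - a z.1 z.2, gradient ψ z.2⟫‖
        ≤ (|p z.1 z.2| + |pK z.1 z.2|) * (‖u z.1 z.2 - a z.1 z.2‖ * Cg) :=
          mul_le_mul (abs_sub _ _) h1 (norm_nonneg _) (by positivity)
      _ = Cg * (|p z.1 z.2| * ‖u z.1 z.2 - a z.1 z.2‖ + |pK z.1 z.2| * ‖u z.1 z.2 - a z.1 z.2‖) := by ring
      _ ≤ Cg * ((2 / 3) * (|p z.1 z.2| ^ (3 / 2 : ℝ) + |pK z.1 z.2| ^ (3 / 2 : ℝ)) +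
            (2 / 3) * (4 * (‖u z.1 z.2‖ ^ 3 + 8 * A ^ 3))) := by
          refine mul_le_mul_of_nonneg_left ?_ hCg0
          nlinarith [hY₁, hY₂, hc3]
  -- ## integrability of `R₄` on `B`: the parabolic gradient bound and the uniform local energy
  have hDa_le : ∀ z ∈ B, ‖fderiv ℝ (a z.1) z.2‖ ≤ C₁ * A * z.1 ^ (-(1 / 2 : ℝ)) := by
    intro z hz
    have ht : 0 < z.1 := hz.1.1
    have h := hgrad z.1 (hIS₀ hz.1) z.2
    have hs : 0 < Real.sqrt z.1 := Real.sqrt_pos.2 ht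
    rw [Real.rpow_neg ht.le, ← Real.sqrt_eq_rpow, ← div_eq_mul_inv, le_div_iff₀ hs, mul_comm]
    exact h
  obtain ⟨Cen, hCen⟩ := hu.uniformLocalEnergy (2 * ρ) (by positivity)
  have hCenI : ∀ᵐ t ∂(volume.restrict I), ∫⁻ x in Kψ, ‖u t x‖ₑ ^ 2 ≤ Cen := by
    filter_upwards [ae_restrict_of_ae_restrict_of_subset hIT' hCen] with t ht
    exact (lintegral_mono_set hK2).trans (ht 0)
  have hrpowI : IntegrableOn (fun t : ℝ => t ^ (-(1 / 2 : ℝ))) I volume :=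
    (intervalIntegral.integrableOn_Ioo_rpow_iff hS).2 (by norm_num)
  have hprodB : volume.restrict B = (volume.restrict I).prod (volume.restrict Kψ) := by
    rw [hB, Measure.prod_restrict, ← Measure.volume_eq_prod]
  have hKvol : volume Kψ < ∞ := hKc.measure_lt_top
  haveI : IsFiniteMeasure (volume.restrict Kψ) := ⟨by rwa [Measure.restrict_apply_univ]⟩
  have hg₄₁ : Integrable (fun z : ℝ × (EuclideanSpace ℝ (Fin 3)) => z.1 ^ (-(1 / 2 : ℝ)) * (8 * A ^ 2)) (volume.restrict B) := by
    rw [hprodB]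
    exact hrpowI.mul_prod (integrable_const (8 * A ^ 2))
  have hg₄₂ : Integrable (fun z : ℝ × (EuclideanSpace ℝ (Fin 3)) => z.1 ^ (-(1 / 2 : ℝ)) * ‖u z.1 z.2‖ ^ 2) (volume.restrict B) := by
    have hm : AEStronglyMeasurable (fun z : ℝ × (EuclideanSpace ℝ (Fin 3)) => z.1 ^ (-(1 / 2 : ℝ)) * ‖u z.1 z.2‖ ^ 2) (volume.restrict B) :=
      ((measurable_fst.pow_const _).aestronglyMeasurable).mul ((hum.mono_measure hresB).norm.pow 2)
    refine ⟨hm, ?_⟩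
    show ∫⁻ z, ‖z.1 ^ (-(1 / 2 : ℝ)) * ‖u z.1 z.2‖ ^ 2‖ₑ ∂(volume.restrict B) < ∞
    have e : ∀ z : ℝ × (EuclideanSpace ℝ (Fin 3)), z ∈ B → ‖z.1 ^ (-(1 / 2 : ℝ)) * ‖u z.1 z.2‖ ^ 2‖ₑ =
        ENNReal.ofReal (z.1 ^ (-(1 / 2 : ℝ))) * ‖u z.1 z.2‖ₑ ^ 2 := by
      intro z hz
      rw [enorm_mul, Real.enorm_eq_ofReal (Real.rpow_nonneg hz.1.1.le _), Real.enorm_eq_ofReal (sq_nonneg _),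
        ENNReal.ofReal_pow (norm_nonneg _), ofReal_norm]
    rw [lintegral_congr_ae (hmemB.mono fun z hz => e z hz), hprodB]
    have hFm : AEMeasurable (fun z : ℝ × (EuclideanSpace ℝ (Fin 3)) => ENNReal.ofReal (z.1 ^ (-(1 / 2 : ℝ))) * ‖u z.1 z.2‖ₑ ^ 2)
        ((volume.restrict I).prod (volume.restrict Kψ)) := by
      rw [← hprodB]
      exact (measurable_fst.pow_const _).ennreal_ofReal.aemeasurable.mul
        ((hum.mono_measure hresB).aemeasurable.enorm.pow_const _)
    rw [lintegral_prod _ hFm]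
    have hslice : ∀ᵐ t ∂(volume.restrict I),
        ∫⁻ x, ENNReal.ofReal (t ^ (-(1 / 2 : ℝ))) * ‖u t x‖ₑ ^ 2 ∂(volume.restrict Kψ) ≤
          ENNReal.ofReal (t ^ (-(1 / 2 : ℝ))) * Cen := by
      filter_upwards [hCenI] with t ht
      rw [lintegral_const_mul' _ _ ENNReal.ofReal_ne_top]
      gcongr
    calc ∫⁻ t, ∫⁻ x, ENNReal.ofReal (t ^ (-(1 / 2 : ℝ))) * ‖u t x‖ₑ ^ 2 ∂(volume.restrict Kψ) ∂(volume.restrict I)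
        ≤ ∫⁻ t, ENNReal.ofReal (t ^ (-(1 / 2 : ℝ))) * Cen ∂(volume.restrict I) := lintegral_mono_ae hslice
      _ = (∫⁻ t, ENNReal.ofReal (t ^ (-(1 / 2 : ℝ))) ∂(volume.restrict I)) * Cen :=
          lintegral_mul_const _ (measurable_id.pow_const _).ennreal_ofReal
      _ < ∞ := by
          refine ENNReal.mul_lt_top ?_ ENNReal.coe_lt_top
          have h := hrpowI.2
          simp only [HasFiniteIntegral] at h
          refine lt_of_le_of_lt (lintegral_mono_ae ?_) h
          filter_upwards [ae_restrict_mem measurableSet_Ioo] with t ht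
          rw [Real.enorm_eq_ofReal (Real.rpow_nonneg ht.1.le _)]
  have hR₄B : Integrable R₄ (volume.restrict B) := by
    have hg : Integrable (fun z : ℝ × (EuclideanSpace ℝ (Fin 3)) => Cψ * (C₁ * A) * (2 * (z.1 ^ (-(1 / 2 : ℝ)) * ‖u z.1 z.2‖ ^ 2) +
        z.1 ^ (-(1 / 2 : ℝ)) * (8 * A ^ 2))) (volume.restrict B) :=
      ((hg₄₂.const_mul 2).add hg₄₁).const_mul _
    refine Integrable.mono' hg (hR₄m.mono_measure hresB) ?_
    filter_upwards [hmemB] with z hz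
    rw [hR₄, norm_mul]
    have ht0 : 0 ≤ z.1 ^ (-(1 / 2 : ℝ)) := Real.rpow_nonneg hz.1.1.le _
    have h1 : ‖⟪fderiv ℝ (a z.1) z.2 (u z.1 z.2 - a z.1 z.2), u z.1 z.2 - a z.1 z.2⟫‖ ≤
        C₁ * A * z.1 ^ (-(1 / 2 : ℝ)) * ‖u z.1 z.2 - a z.1 z.2‖ ^ 2 := by
      refine (norm_inner_le_norm _ _).trans ?_
      rw [pow_two, ← mul_assoc]
      refine mul_le_mul_of_nonneg_right ((ContinuousLinearMap.le_opNorm _ _).trans ?_) (norm_nonneg _)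
      exact mul_le_mul_of_nonneg_right (hDa_le z hz) (norm_nonneg _)
    calc ‖ψ z.2‖ * ‖⟪fderiv ℝ (a z.1) z.2 (u z.1 z.2 - a z.1 z.2), u z.1 z.2 - a z.1 z.2⟫‖
        ≤ Cψ * (C₁ * A * z.1 ^ (-(1 / 2 : ℝ)) * (2 * ‖u z.1 z.2‖ ^ 2 + 8 * A ^ 2)) := by
          refine mul_le_mul (hψle _) (h1.trans ?_) (norm_nonneg _) hCψ0
          exact mul_le_mul_of_nonneg_left (hvsq z hz) (by positivity)
      _ = Cψ * (C₁ * A) * (2 * (z.1 ^ (-(1 / 2 : ℝ)) * ‖u z.1 z.2‖ ^ 2) + z.1 ^ (-(1 / 2 : ℝ)) * (8 * A ^ 2)) := by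
          ring
  -- ## from the box to the strip
  refine ⟨integrableOn_strip_of_box hWB (fun z hz => by simp only [hW, hψK _ hz, mul_zero]) measurableSet_Ioo hKc.measurableSet,
    integrableOn_strip_of_box hR₁B (fun z hz => by simp only [hR₁, hLK0 _ hz, mul_zero]) measurableSet_Ioo hKc.measurableSet,
    integrableOn_strip_of_box hR₂B (fun z hz => by simp only [hR₂, hgK _ hz, inner_zero_right, mul_zero])
      measurableSet_Ioo hKc.measurableSet,
    integrableOn_strip_of_box hR₃B (fun z hz => by simp only [hR₃, hgK _ hz, inner_zero_right, mul_zero])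
      measurableSet_Ioo hKc.measurableSet,
    integrableOn_strip_of_box hR₄B (fun z hz => by simp only [hR₄, hψK _ hz, zero_mul]) measurableSet_Ioo hKc.measurableSet⟩

/-! ### The weak gradient of the perturbation -/

/-- **`G - Da` is a weak spatial gradient of `v = u - a`** on every open `Q ⊆ (0,T') × ℝ³` inside
the smoothness slab `(0,S₂) × ℝ³` of `a` (the classical slice derivative of the jointly `C¹` field
`a` is a weak spatial gradient, `hasWeakSpatialGradientOn_of_contDiffOn`; linearity,
`HasWeakSpatialGradientOn.add`). [folklore] -/
theorem hasWeakSpatialGradientOn_sub_flow {T' S₂ : ℝ}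
    {u a : ℝ → (EuclideanSpace ℝ (Fin 3)) → (EuclideanSpace ℝ (Fin 3))} {π : ℝ → (EuclideanSpace ℝ (Fin 3)) → ℝ}
    {G : ℝ → (EuclideanSpace ℝ (Fin 3)) → (EuclideanSpace ℝ (Fin 3)) →L[ℝ] (EuclideanSpace ℝ (Fin 3))}
    (hG : HasWeakSpatialGradientOn (slab (EuclideanSpace ℝ (Fin 3)) (Ioo 0 T') isOpen_Ioo) u G)
    (hcl : IsClassicalNSSolutionOn (Ioo 0 S₂) 1 0 a π)
    {Q : Opens (ℝ × EuclideanSpace ℝ (Fin 3))}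
    (hQT : Q ≤ slab (EuclideanSpace ℝ (Fin 3)) (Ioo 0 T') isOpen_Ioo)
    (hQS : (Q : Set (ℝ × EuclideanSpace ℝ (Fin 3))) ⊆ Ioo 0 S₂ ×ˢ (univ : Set (EuclideanSpace ℝ (Fin 3)))) :
    HasWeakSpatialGradientOn Q (fun t x => u t x - a t x) (fun t x => G t x - fderiv ℝ (a t) x) := by
  have ha1 : ContDiffOn ℝ 1 (uncurry fun t x => -a t x) (Ioo 0 S₂ ×ˢ (univ : Set (EuclideanSpace ℝ (Fin 3)))) := by
    have h := (hcl.smooth_velocity.of_le (show ((1 : ℕ) : WithTop ℕ∞) ≤ _ by norm_cast)).neg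
    exact h
  have hneg := hasWeakSpatialGradientOn_of_contDiffOn (Q := Q) isOpen_Ioo hQS ha1
  have e : (fun t x => fderiv ℝ ((fun t x => -a t x) t) x) = fun t (x : EuclideanSpace ℝ (Fin 3)) => -fderiv ℝ (a t) x := by
    funext t x
    exact fderiv_neg
  rw [e] at hneg
  have hsum := (hG.mono hQT).add hneg
  have e1 : (fun t x => u t x + (fun t x => -a t x) t x) = fun t (x : EuclideanSpace ℝ (Fin 3)) => u t x - a t x := by
    funext t x; simp [sub_eq_add_neg]
  have e2 : (fun t x => G t x + (fun t x => -fderiv ℝ (a t) x) t x) =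
      fun t (x : EuclideanSpace ℝ (Fin 3)) => G t x - fderiv ℝ (a t) x := by
    funext t x; simp [sub_eq_add_neg]
  rw [e1, e2] at hsum
  exact hsum

/-! ### The good slices of the pair `(a, u)` -/

set_option maxHeartbeats 1600000 in
/-- **The a.e. slice data of the pair `(a, u)` consumed by `slice_pressure_pairing_le_local`**
(the analogue of the tree's `WeakStrongSetting.ae_good_slice` for two local Leray solutions with
different data): for a centre `y`, a radius `ρ > 0` and a time `0 < t ≤ min(T', S₀)` with finite
dissipation `∫∫_{(0,t)×B_{2ρ}(y)} |G - Da|² < ∞`, there is a finite `A_e` such that for a.e.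
`s ∈ (0,t)`: the slices `a(s), u(s)` are measurable with unit-ball energies `≤ A_e`, they are in
`L³(B_{2ρ}(y))`, `a(s) - u(s) ∈ L⁶(B_{2ρ}(y))` (Sobolev on the ball with the weak gradient
`Da(s) - G(s)`), both pressures have the local expansion of Kang–Miura–Tsai Lemma 3.4 on `B_ρ(y)`
with measurable far fields, and `a(s) - u(s)` is weakly divergence free. [folklore] -/
theorem ae_good_slice_pair {T' S₀ S₂ A : ℝ}
    {u₀ a₀ : (EuclideanSpace ℝ (Fin 3)) → (EuclideanSpace ℝ (Fin 3))} {u a : ℝ → (EuclideanSpace ℝ (Fin 3)) → (EuclideanSpace ℝ (Fin 3))}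
    {p π pK : ℝ → (EuclideanSpace ℝ (Fin 3)) → ℝ}
    {G : ℝ → (EuclideanSpace ℝ (Fin 3)) → (EuclideanSpace ℝ (Fin 3)) →L[ℝ] (EuclideanSpace ℝ (Fin 3))}
    (hu : IsLocalLeraySolutionOn T' 1 u₀ u p)
    (hG : HasWeakSpatialGradientOn (slab (EuclideanSpace ℝ (Fin 3)) (Ioo 0 T') isOpen_Ioo) u G)
    (hS₀₂ : S₀ ≤ S₂)
    (hLK : IsLocalLeraySolutionOn S₀ 1 a₀ a pK) (hcl : IsClassicalNSSolutionOn (Ioo 0 S₂) 1 0 a π)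
    (hbd : ∀ t ∈ Ioo 0 S₂, ∀ x, ‖a t x‖ ≤ 2 * A)
    (y : EuclideanSpace ℝ (Fin 3)) {ρ : ℝ} (hρ : 0 < ρ) {t : ℝ} (htS : t ≤ min T' S₀)
    (hfin : ∫⁻ z in Ioo 0 t ×ˢ ball y (2 * ρ),
      ENNReal.ofReal (frobeniusNormSq (G z.1 z.2 - fderiv ℝ (a z.1) z.2)) < ⊤) :
    ∃ Ae : ℝ≥0∞, Ae ≠ ⊤ ∧ ∀ᵐ s ∂(volume.restrict (Ioo 0 t)),
      AEStronglyMeasurable (a s) volume ∧ AEStronglyMeasurable (u s) volume ∧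
      (∀ z, ∫⁻ x in ball z 1, ‖a s x‖ₑ ^ 2 ≤ Ae) ∧ (∀ z, ∫⁻ x in ball z 1, ‖u s x‖ₑ ^ 2 ≤ Ae) ∧
      (∫⁻ x in ball y (2 * ρ), ‖a s x‖ₑ ^ (3 : ℕ) ≠ ⊤) ∧ (∫⁻ x in ball y (2 * ρ), ‖u s x‖ₑ ^ (3 : ℕ) ≠ ⊤) ∧
      eLpNorm (fun x => a s x - u s x) 6 (volume.restrict (ball y (2 * ρ))) ≠ ⊤ ∧
      (∃ κ₁ : ℝ, ∀ᵐ x ∂(volume.restrict (ball y ρ)),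
        pK s x = localPressureNear y ρ a s x + localPressureFar y ρ a s x + κ₁) ∧
      (∃ κ₂ : ℝ, ∀ᵐ x ∂(volume.restrict (ball y ρ)),
        p s x = localPressureNear y ρ u s x + localPressureFar y ρ u s x + κ₂) ∧
      AEStronglyMeasurable (localPressureFar y ρ a s) volume ∧
      AEStronglyMeasurable (localPressureFar y ρ u s) volume ∧
      (∀ θ : EuclideanSpace ℝ (Fin 3) → ℝ, FunctionSpaces.IsTestFunctionOn (⊤ : Opens (EuclideanSpace ℝ (Fin 3))) θ →
        ∫ x, ⟪a s x - u s x, gradient θ x⟫ = 0) := by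
  set S : ℝ := min T' S₀ with hSdef
  have htT' : t ≤ T' := htS.trans (min_le_left _ _)
  have htS₀ : t ≤ S₀ := htS.trans (min_le_right _ _)
  have htS₂ : t ≤ S₂ := htS₀.trans hS₀₂
  have hIT' : Ioo 0 t ⊆ Ioo 0 T' := Ioo_subset_Ioo_right htT'
  have hIS₂ : Ioo 0 t ⊆ Ioo 0 S₂ := Ioo_subset_Ioo_right htS₂
  have hu' : IsLocalLeraySolutionOn t 1 u₀ u p := hu.mono htT'
  have ha' : IsLocalLeraySolutionOn t 1 a₀ a pK := hLK.mono htS₀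
  -- the uniformly local energy bounds
  obtain ⟨C₁, hC₁⟩ := ha'.uniformLocalEnergy 1 one_pos
  obtain ⟨C₂, hC₂⟩ := hu'.uniformLocalEnergy 1 one_pos
  obtain ⟨C₃, hC₃⟩ := hu'.uniformLocalEnergy (2 * ρ) (by positivity)
  set Ae : ℝ≥0∞ := max (C₁ : ℝ≥0∞) C₂ with hAe
  have hAet : Ae ≠ ⊤ := by simp [hAe]
  refine ⟨Ae, hAet, ?_⟩
  -- the weak gradient of `v = u - a` on the cylinder `(0,t) × B_{2ρ}(y)` and the slice data
  set Ω : Opens (EuclideanSpace ℝ (Fin 3)) := ⟨ball y (2 * ρ), isOpen_ball⟩ with hΩ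
  have hQT : (timeCylinder Ω 0 t : Opens (ℝ × EuclideanSpace ℝ (Fin 3))) ≤
      slab (EuclideanSpace ℝ (Fin 3)) (Ioo 0 T') isOpen_Ioo := fun z hz => mem_slab.2 (hIT' hz.1)
  have hQS : ((timeCylinder Ω 0 t : Opens (ℝ × EuclideanSpace ℝ (Fin 3))) : Set (ℝ × EuclideanSpace ℝ (Fin 3))) ⊆
      Ioo 0 S₂ ×ˢ (univ : Set (EuclideanSpace ℝ (Fin 3))) := fun z hz => ⟨hIS₂ hz.1, mem_univ _⟩
  have hv : HasWeakSpatialGradientOn (timeCylinder Ω 0 t) (fun s x => u s x - a s x)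
      (fun s x => G s x - fderiv ℝ (a s) x) := hasWeakSpatialGradientOn_sub_flow hG hcl hQT hQS
  have hslice : ∀ᵐ s ∂(volume.restrict (Ioo 0 t)),
      FunctionSpaces.HasWeakFDerivOn Ω volume (fun x => u s x - a s x) (fun x => G s x - fderiv ℝ (a s) x) :=
    HasWeakSpatialGradientOn.ae_hasWeakFDerivOn_slice (Ω := Ω) hv
  -- finiteness of the dissipation of a.e. slice
  have hGm : AEStronglyMeasurable (uncurry fun s x => G s x - fderiv ℝ (a s) x)
      (volume.restrict (Ioo 0 t ×ˢ ball y (2 * ρ))) :=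
    (hv.locallyIntegrableOn_grad.mono_set (fun z hz => hz)).aestronglyMeasurable
  have hprod : (volume.restrict (Ioo 0 t ×ˢ ball y (2 * ρ)) : Measure (ℝ × EuclideanSpace ℝ (Fin 3))) =
      (volume.restrict (Ioo 0 t)).prod (volume.restrict (ball y (2 * ρ))) := by
    rw [Measure.volume_eq_prod, Measure.prod_restrict]
  have hDm : AEMeasurable (fun z : ℝ × EuclideanSpace ℝ (Fin 3) =>
      ENNReal.ofReal (frobeniusNormSq (G z.1 z.2 - fderiv ℝ (a z.1) z.2)))
      ((volume.restrict (Ioo 0 t)).prod (volume.restrict (ball y (2 * ρ)))) := by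
    rw [← hprod]
    exact (continuous_frobeniusNormSq'.comp_aestronglyMeasurable hGm).aemeasurable.ennreal_ofReal
  have hDfin : ∀ᵐ s ∂(volume.restrict (Ioo 0 t)),
      ∫⁻ x in ball y (2 * ρ), ENNReal.ofReal (frobeniusNormSq (G s x - fderiv ℝ (a s) x)) < ⊤ := by
    refine ae_lt_top' hDm.lintegral_prod_right' ?_
    rw [← lintegral_prod _ hDm, hprod.symm]
    exact hfin.ne
  -- Sobolev on the ball
  obtain ⟨CS, hCS⟩ := exists_eLpNorm_six_le_ball_uniform (E := EuclideanSpace ℝ (Fin 3))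
    finrank_euclideanSpace_fin (2 * ρ)
  -- divergence-freeness of a.e. slice
  have habu : Ioo (0 : ℝ) t ×ˢ (univ : Set (EuclideanSpace ℝ (Fin 3))) ⊆
      ((slab (EuclideanSpace ℝ (Fin 3)) (Ioo 0 t) isOpen_Ioo : Opens (ℝ × EuclideanSpace ℝ (Fin 3))) :
        Set (ℝ × EuclideanSpace ℝ (Fin 3))) := by
    rw [coe_slab]
  have hdivu : ∀ᵐ s ∂(volume.restrict (Ioo 0 t)), IsWeaklyDivFree (u s) :=
    (ae_restrict_iff' measurableSet_Ioo).2 (SuitableRestart.ae_isWeaklyDivFree_slice hu'.suitable habu)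
  have hdiva : ∀ᵐ s ∂(volume.restrict (Ioo 0 t)), IsWeaklyDivFree (a s) :=
    (ae_restrict_iff' measurableSet_Ioo).2 (SuitableRestart.ae_isWeaklyDivFree_slice ha'.suitable habu)
  filter_upwards [hu'.ae_aestronglyMeasurable_slice', hC₁, hC₂, hC₃, ha'.ae_lintegral_cube_ball_lt_top y (2 * ρ),
    hu'.ae_lintegral_cube_ball_lt_top y (2 * ρ), hslice, hDfin,
    ha'.ae_exists_slice_representation y hρ, hu'.ae_exists_slice_representation y hρ,
    ha'.ae_aestronglyMeasurable_localPressureFar_slice y ρ, hu'.ae_aestronglyMeasurable_localPressureFar_slice y ρ,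
    hdivu, hdiva, ae_restrict_mem measurableSet_Ioo]
    with s hum h1 h2 h3 hca hcu hws hDs hrep₁ hrep₂ hF₁ hF₂ hdu hda hsI
  have hsS₂ : s ∈ Ioo (0 : ℝ) S₂ := hIS₂ hsI
  have hacont : Continuous (a s) := (hcl.contDiff_velocity hsS₂).continuous
  have ham : AEStronglyMeasurable (a s) volume := hacont.aestronglyMeasurable
  have hA₁ : ∀ z, ∫⁻ x in ball z 1, ‖a s x‖ₑ ^ 2 ≤ Ae := fun z => (h1 z).trans (le_max_left _ _)
  have hA₂ : ∀ z, ∫⁻ x in ball z 1, ‖u s x‖ₑ ^ 2 ≤ Ae := fun z => (h2 z).trans (le_max_right _ _)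
  -- `v(s) ∈ L²(B_{2ρ}(y))`
  have haB : ∫⁻ x in ball y (2 * ρ), ‖a s x‖ₑ ^ 2 ≤ ENNReal.ofReal ((2 * A) ^ 2) * volume (ball y (2 * ρ)) := by
    calc ∫⁻ x in ball y (2 * ρ), ‖a s x‖ₑ ^ 2 ≤ ∫⁻ x in ball y (2 * ρ), ENNReal.ofReal ((2 * A) ^ 2) := by
          refine lintegral_mono fun x => ?_
          rw [← ofReal_norm, ← ENNReal.ofReal_pow (norm_nonneg _)]
          exact ENNReal.ofReal_le_ofReal (pow_le_pow_left₀ (norm_nonneg _) (hbd s hsS₂ x) 2)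
      _ = ENNReal.ofReal ((2 * A) ^ 2) * volume (ball y (2 * ρ)) := setLIntegral_const _ _
  have hvB : ∫⁻ x in ball y (2 * ρ), ‖u s x - a s x‖ₑ ^ 2 ≠ ⊤ := by
    have hle : ∫⁻ x in ball y (2 * ρ), ‖u s x - a s x‖ₑ ^ 2 ≤
        2 * (∫⁻ x in ball y (2 * ρ), ‖u s x‖ₑ ^ 2) + 2 * ∫⁻ x in ball y (2 * ρ), ‖a s x‖ₑ ^ 2 := by
      calc ∫⁻ x in ball y (2 * ρ), ‖u s x - a s x‖ₑ ^ 2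
          ≤ ∫⁻ x in ball y (2 * ρ), (2 * ‖u s x‖ₑ ^ 2 + 2 * ‖a s x‖ₑ ^ 2) := by
            refine lintegral_mono fun x => ?_
            calc ‖u s x - a s x‖ₑ ^ 2 ≤ (‖u s x‖ₑ + ‖a s x‖ₑ) ^ 2 := by
                  gcongr; exact enorm_sub_le
              _ ≤ 2 * ‖u s x‖ₑ ^ 2 + 2 * ‖a s x‖ₑ ^ 2 := PoincareBall.add_sq_le_two_mul_sq_add _ _
        _ = 2 * (∫⁻ x in ball y (2 * ρ), ‖u s x‖ₑ ^ 2) + 2 * ∫⁻ x in ball y (2 * ρ), ‖a s x‖ₑ ^ 2 := by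
            have m₁ : AEMeasurable (fun x => ‖u s x‖ₑ ^ 2) (volume.restrict (ball y (2 * ρ))) := (hum.enorm.pow_const 2).restrict
            have m₂ : AEMeasurable (fun x => ‖a s x‖ₑ ^ 2) (volume.restrict (ball y (2 * ρ))) := (ham.enorm.pow_const 2).restrict
            rw [lintegral_add_left' (m₁.const_mul _), lintegral_const_mul'' _ m₁, lintegral_const_mul'' _ m₂]
    refine ne_top_of_le_ne_top ?_ hle
    refine ENNReal.add_ne_top.2 ⟨ENNReal.mul_ne_top ENNReal.ofNat_ne_top (ne_top_of_le_ne_top ENNReal.coe_ne_top (h3 y)),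
      ENNReal.mul_ne_top ENNReal.ofNat_ne_top (ne_top_of_le_ne_top ?_ haB)⟩
    exact ENNReal.mul_ne_top ENNReal.ofReal_ne_top measure_ball_lt_top.ne
  have hE2 : eLpNorm (fun x => u s x - a s x) 2 (volume.restrict (ball y (2 * ρ))) ≠ ∞ := by
    rw [eLpNorm_eq_lintegral_rpow_enorm_toReal two_ne_zero ENNReal.ofNat_ne_top, ENNReal.toReal_ofNat]
    refine ENNReal.rpow_ne_top_of_nonneg (by norm_num) ?_
    have e : ∫⁻ x in ball y (2 * ρ), ‖u s x - a s x‖ₑ ^ (2 : ℝ) = ∫⁻ x in ball y (2 * ρ), ‖u s x - a s x‖ₑ ^ 2 :=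
      lintegral_congr fun x => by rw [show (2 : ℝ) = ((2 : ℕ) : ℝ) by norm_num, ENNReal.rpow_natCast]
    rw [e]
    exact hvB
  -- `v(s) ∈ L⁶(B_{2ρ}(y))`
  have h6 : eLpNorm (fun x => u s x - a s x) 6 (volume.restrict (ball y (2 * ρ))) ≠ ⊤ := by
    refine ne_top_of_le_ne_top ?_ (hCS y _ _ hws hE2)
    refine ENNReal.mul_ne_top ENNReal.coe_ne_top (ENNReal.add_ne_top.2 ⟨hE2, ?_⟩)
    exact ENNReal.rpow_ne_top_of_nonneg (by norm_num) hDs.ne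
  have h6' : eLpNorm (fun x => a s x - u s x) 6 (volume.restrict (ball y (2 * ρ))) ≠ ⊤ := by
    have e : (fun x => a s x - u s x) = -(fun x => u s x - a s x) := by
      funext x; simp only [Pi.neg_apply]; abel
    rw [e, eLpNorm_neg]
    exact h6
  -- divergence-freeness of `a(s) - u(s)`
  have hdiv : ∀ θ : EuclideanSpace ℝ (Fin 3) → ℝ, FunctionSpaces.IsTestFunctionOn (⊤ : Opens (EuclideanSpace ℝ (Fin 3))) θ →
      ∫ x, ⟪a s x - u s x, gradient θ x⟫ = 0 := by
    intro θ hθ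
    have i₁ := LemarieRieusset2016.integrable_inner_gradient_of_uloc ham hAet hA₁ hθ
    have i₂ := LemarieRieusset2016.integrable_inner_gradient_of_uloc hum hAet hA₂ hθ
    have e : (fun x => ⟪a s x - u s x, gradient θ x⟫) = fun x => ⟪a s x, gradient θ x⟫ - ⟪u s x, gradient θ x⟫ :=
      funext fun x => inner_sub_left _ _ _
    rw [e, integral_sub i₁ i₂, hda θ hθ, hdu θ hθ, sub_zero]
  exact ⟨ham, hum, hA₁, hA₂, hca.ne, hcu.ne, h6', hrep₁, hrep₂, hF₁, hF₂, hdiv⟩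

/-! ### Tools for the step -/

/-- `∫₀ᵇ σ^{-1/2} dσ = 2 b^{1/2}` as a set `∫⁻` (`b > 0`; private copy of the tree's
`setLIntegral_Ioo_rpow_neg_half` of `KochTataruPointwise.lean`, not in the import closure).
[folklore] -/
private theorem setLIntegral_Ioo_rpow_neg_half' {b : ℝ} (hb : 0 < b) :
    ∫⁻ σ in Ioo 0 b, ENNReal.ofReal (σ ^ (-(1 / 2 : ℝ))) = ENNReal.ofReal (2 * Real.sqrt b) := by
  have hr : (-1 : ℝ) < -(1 / 2 : ℝ) := by norm_num
  have hint : IntegrableOn (fun σ : ℝ => σ ^ (-(1 / 2 : ℝ))) (Ioo 0 b) := by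
    have h := (intervalIntegral.intervalIntegrable_rpow' hr (a := 0) (b := b))
    rw [intervalIntegrable_iff_integrableOn_Ioo_of_le hb.le] at h
    exact h
  rw [← ofReal_integral_eq_lintegral_ofReal hint]
  · congr 1
    rw [← integral_Ioc_eq_integral_Ioo, ← intervalIntegral.integral_of_le hb.le,
      integral_rpow (Or.inl hr)]
    rw [Real.zero_rpow (by norm_num), Real.sqrt_eq_rpow]
    norm_num
    field_simp
  · refine (ae_restrict_iff' measurableSet_Ioo).2 (Eventually.of_forall fun σ hσ => ?_)
    exact Real.rpow_nonneg hσ.1.le _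

/-- **Tonelli with an a.e. slice bound**: if `∫_{B} f(s, ·) ≤ E` for a.e. `s ∈ (0,t)` and `f`
is measurable on `(0,t) × B`, then `∫∫_{(0,t)×B} w(s) f ≤ E ∫₀ᵗ w` for a measurable weight `w`.
[folklore] -/
theorem lintegral_prod_le_of_ae_slice_le {t : ℝ} {B : Set (EuclideanSpace ℝ (Fin 3))} (_hB : MeasurableSet B)
    {f : ℝ × (EuclideanSpace ℝ (Fin 3)) → ℝ≥0∞} (hf : AEMeasurable f (volume.restrict (Ioo 0 t ×ˢ B)))
    {w : ℝ → ℝ≥0∞} (hw : Measurable w) (hw' : ∀ s, w s ≠ ∞) {E : ℝ≥0∞}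
    (hE : ∀ᵐ s ∂(volume.restrict (Ioo 0 t)), ∫⁻ x in B, f (s, x) ≤ E) :
    ∫⁻ z in Ioo 0 t ×ˢ B, w z.1 * f z ≤ E * ∫⁻ s in Ioo 0 t, w s := by
  have hprod : (volume.restrict (Ioo 0 t ×ˢ B) : Measure (ℝ × EuclideanSpace ℝ (Fin 3))) =
      (volume.restrict (Ioo 0 t)).prod (volume.restrict B) := by
    rw [Measure.volume_eq_prod, Measure.prod_restrict]
  have hwf : AEMeasurable (fun z : ℝ × EuclideanSpace ℝ (Fin 3) => w z.1 * f z)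
      ((volume.restrict (Ioo 0 t)).prod (volume.restrict B)) := by
    rw [← hprod]; exact ((hw.comp measurable_fst).aemeasurable).mul hf
  rw [hprod, lintegral_prod _ hwf]
  calc ∫⁻ s, ∫⁻ x, w (s, x).1 * f (s, x) ∂(volume.restrict B) ∂(volume.restrict (Ioo 0 t))
      = ∫⁻ s, w s * ∫⁻ x, f (s, x) ∂(volume.restrict B) ∂(volume.restrict (Ioo 0 t)) := by
        refine lintegral_congr_ae (Eventually.of_forall fun s => ?_)
        exact lintegral_const_mul' _ _ (hw' s)
    _ ≤ ∫⁻ s, w s * E ∂(volume.restrict (Ioo 0 t)) := lintegral_mono_ae (hE.mono fun s hs => mul_le_mul' le_rfl hs)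
    _ = E * ∫⁻ s in Ioo 0 t, w s := by
        rw [lintegral_mul_const _ hw, mul_comm]

/-! ### The step estimate -/

set_option maxHeartbeats 6400000 in
/-- **One step of the decay iteration** (Jia–Šverák 2014, proof of Thm. 3.1, arXiv p. 8: the
local energy inequality for `v` on `B_{4/3}(x₀)` and "by well-known interpolation
inequalities … `≤ C(α, m, M) t^{1/10}`", iterated here on shrinking balls). Fix a radius
`0 < r ≤ 1` and a cut-off `Ψ ∈ C_c^∞(B_{r/2}(0))`, `Ψ ≥ 0`. There is `C = C(r, Ψ)` such that
for the data of `ae_perturbed_energy_slice` (a local Leray solution `(u,p)`, the regular flow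
`(a, p_K, π)` with `|a| ≤ 2A`, `√t|∇a| ≤ C₁A`, data agreeing on `B_{ρ₀}(x₀) ⊇ B_r(y)`), a bound
`α²` of the uniformly local energy of `v = u - a`, and `0 < t ≤ min(T', S₀, 1)`: if
`∫_{B_r(y)} |v(s)|² ≤ E` for a.e. `s ∈ (0,t)` and `∫∫_{(0,t)×B_r(y)} |G - Da|² ≤ E`, then for
a.e. `s ∈ (0,t)`,
`∫ |v(s)|² Ψ(· - y) + 2 ∫∫_{(0,s)} |G - Da|² Ψ(· - y) ≤ C [(1 + A + C₁A) √t E + t^{1/4} E^{3/2} + (A α + α²) t E^{1/2}]`.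
The four flux terms of `ae_perturbed_energy_slice`: `|v|²Δψ ≤ C t E`; `|v|² u·∇ψ ≤ C(2A t E + ∫∫|v|³)`
with `∫∫_{(0,t)×B_r(y)}|v|³ ≤ K E^{3/2}(t + t^{1/4})` (`exists_lintegral_cube_cylinder_le_ball`);
`ψ⟪Da v, v⟫ ≤ C C₁A E ∫₀ᵗ s^{-1/2} = 2 C C₁A √t E`; the pressure pairing slice by slice
(`slice_pressure_pairing_le_local` with `u₁ = u₃ = a`, `u₂ = u`, `m = 2A`, `ε = 0`, the local
expansions of `p_K` and `p` at `(y, r/2)`, the uniformly local tails of `v`).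
[cite: JiaSverak2014, §3 proof of Thm. 3.1 (arXiv p. 8)] [cite: LemarieRieusset2016, Prop. 14.1 and proof of Thm. 14.7 (pp. 515–518)] -/
theorem energy_step {r : ℝ} (hr : 0 < r) (hr1 : r ≤ 1) {Ψ : (EuclideanSpace ℝ (Fin 3)) → ℝ}
    (hΨ : ContDiff ℝ (⊤ : ℕ∞) Ψ) (hΨs : tsupport Ψ ⊆ ball (0 : EuclideanSpace ℝ (Fin 3)) (r / 2))
    (hΨ0 : ∀ x, 0 ≤ Ψ x) :
    ∃ Cst : ℝ≥0, ∀ {T' S₀ S₂ A C₁ : ℝ}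
      {u₀ a₀ : (EuclideanSpace ℝ (Fin 3)) → (EuclideanSpace ℝ (Fin 3))} {u a : ℝ → (EuclideanSpace ℝ (Fin 3)) → (EuclideanSpace ℝ (Fin 3))}
      {p π pK : ℝ → (EuclideanSpace ℝ (Fin 3)) → ℝ}
      {G : ℝ → (EuclideanSpace ℝ (Fin 3)) → (EuclideanSpace ℝ (Fin 3)) →L[ℝ] (EuclideanSpace ℝ (Fin 3))}
      {x₀ y : EuclideanSpace ℝ (Fin 3)} {ρ₀ : ℝ} {αv Ek : ℝ≥0} {t : ℝ},
      0 < T' → AEStronglyMeasurable u₀ volume → IsLocalLeraySolutionOn T' 1 u₀ u p →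
      HasWeakSpatialGradientOn (slab (EuclideanSpace ℝ (Fin 3)) (Ioo 0 T') isOpen_Ioo) u G →
      (∀ R : ℝ, 0 < R → ∃ C : ℝ≥0, ∀ y' : (EuclideanSpace ℝ (Fin 3)),
        ∫⁻ z in Ioo 0 T' ×ˢ ball y' R, ENNReal.ofReal (frobeniusNormSq (G z.1 z.2)) ≤ C) →
      0 < S₀ → S₀ ≤ S₂ → 0 < A → 0 ≤ C₁ →
      IsLocalLeraySolutionOn S₀ 1 a₀ a pK → IsClassicalNSSolutionOn (Ioo 0 S₂) 1 0 a π →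
      (∀ t' ∈ Ioo 0 S₂, ∀ x, ‖a t' x‖ ≤ 2 * A) →
      (∀ t' ∈ Ioo 0 S₀, ∀ x, Real.sqrt t' * ‖fderiv ℝ (a t') x‖ ≤ C₁ * A) →
      0 < ρ₀ → (∀ x ∈ ball x₀ ρ₀, a₀ x = u₀ x) → ball y r ⊆ ball x₀ ρ₀ →
      (∀ᵐ τ ∂(volume.restrict (Ioo 0 (min T' S₀))), ∀ z : EuclideanSpace ℝ (Fin 3),
        ∫⁻ x in ball z 1, ‖u τ x - a τ x‖ₑ ^ 2 ≤ αv) →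
      0 < t → t ≤ min T' S₀ → t ≤ 1 →
      (∀ᵐ s ∂(volume.restrict (Ioo 0 t)), ∫⁻ x in ball y r, ‖u s x - a s x‖ₑ ^ 2 ≤ Ek) →
      ∫⁻ z in Ioo 0 t ×ˢ ball y r, ENNReal.ofReal (frobeniusNormSq (G z.1 z.2 - fderiv ℝ (a z.1) z.2)) ≤ Ek →
      ∀ᵐ s ∂(volume.restrict (Ioo 0 t)),
        ENNReal.ofReal (∫ x, ‖u s x - a s x‖ ^ 2 * Ψ (x - y)) +
            2 * ∫⁻ z in Ioo 0 s ×ˢ (univ : Set (EuclideanSpace ℝ (Fin 3))),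
              ENNReal.ofReal (frobeniusNormSq (G z.1 z.2 - fderiv ℝ (a z.1) z.2) * Ψ (z.2 - y)) ≤
          Cst * ((1 + ENNReal.ofReal A + ENNReal.ofReal (C₁ * A)) * ENNReal.ofReal (Real.sqrt t) * Ek +
            ENNReal.ofReal (t ^ (1 / 4 : ℝ)) * (Ek : ℝ≥0∞) ^ (3 / 2 : ℝ) +
            (ENNReal.ofReal A * (αv : ℝ≥0∞) ^ (1 / 2 : ℝ) + αv) * ENNReal.ofReal t * (Ek : ℝ≥0∞) ^ (1 / 2 : ℝ)) := by
  -- ## the data of `Ψ`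
  have hΨc : HasCompactSupport Ψ :=
    (isCompact_closedBall (0 : EuclideanSpace ℝ (Fin 3)) (r / 2)).of_isClosed_subset (isClosed_tsupport Ψ)
      (hΨs.trans Metric.ball_subset_closedBall)
  have hΨK : ∀ x ∉ tsupport Ψ, Ψ x = 0 := fun x hx => image_eq_zero_of_notMem_tsupport hx
  have hgΨK : ∀ x ∉ tsupport Ψ, gradient Ψ x = 0 := fun x hx => by
    have h0 : Ψ =ᶠ[𝓝 x] fun _ => (0 : ℝ) := notMem_tsupport_iff_eventuallyEq.1 hx
    rw [gradient, h0.fderiv_eq, fderiv_fun_const, Pi.zero_apply, map_zero]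
  have hLΨK : ∀ x ∉ tsupport Ψ, (Δ Ψ) x = 0 := fun x hx => laplacian_eq_zero_of_notMem_tsupport hx
  have hΨcont : Continuous Ψ := hΨ.continuous
  have hgΨcont : Continuous fun x => gradient Ψ x :=
    (InnerProductSpace.toDual ℝ (EuclideanSpace ℝ (Fin 3))).symm.continuous.comp (hΨ.continuous_fderiv (by simp))
  have hLΨcont : Continuous fun x => (Δ Ψ) x := continuous_laplacian (hΨ.of_le (by norm_cast))
  obtain ⟨Cψ, hCψ⟩ := hΨcont.bounded_above_of_compact_support hΨc
  obtain ⟨Cg, hCg⟩ := hgΨcont.bounded_above_of_compact_support (HasCompactSupport.intro hΨc fun x hx => hgΨK x hx)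
  obtain ⟨CL, hCL⟩ := hLΨcont.bounded_above_of_compact_support (HasCompactSupport.intro hΨc fun x hx => hLΨK x hx)
  have hCψ0 : 0 ≤ Cψ := (norm_nonneg _).trans (hCψ 0)
  have hCg0 : 0 ≤ Cg := (norm_nonneg _).trans (hCg 0)
  have hCL0 : 0 ≤ CL := (norm_nonneg _).trans (hCL 0)
  -- ## the constants
  have hρ0 : 0 < r / 2 := by positivity
  have hρ1 : r / 2 ≤ 1 := by linarith
  obtain ⟨Csl, hCsl⟩ := slice_pressure_pairing_le_local (B := Cg) hρ0 hρ1
  obtain ⟨Kc, hKc⟩ := exists_lintegral_cube_cylinder_le_ball r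
  obtain ⟨Kt, hKtt, hKtail⟩ := exists_farField_tail_le (r := r / 2) hρ0
  set τt : ℝ≥0∞ := Kt * ENNReal.ofReal ((r - r / 2)⁻¹) with hτt
  have hτtt : τt ≠ ⊤ := ENNReal.mul_ne_top hKtt ENNReal.ofReal_ne_top
  set CLₑ : ℝ≥0∞ := ENNReal.ofReal CL with hCLₑ
  set Cgₑ : ℝ≥0∞ := ENNReal.ofReal Cg with hCgₑ
  set Cψₑ : ℝ≥0∞ := ENNReal.ofReal Cψ with hCψₑ
  -- coefficients of the three groups
  set cX : ℝ≥0∞ := CLₑ + 2 * Cgₑ + 4 * (Csl : ℝ≥0∞) + 4 * Cψₑ with hcX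
  set cY : ℝ≥0∞ := 2 * Cgₑ * Kc + 4 * (Csl : ℝ≥0∞) * Kc with hcY
  set cZ : ℝ≥0∞ := 2 * (Csl : ℝ≥0∞) * (2 + τt) with hcZ
  set C : ℝ≥0∞ := cX + cY + cZ with hC
  have hCt : C ≠ ⊤ := by simp only [hC, hcX, hcY, hcZ, hCLₑ, hCgₑ, hCψₑ]; finiteness
  refine ⟨C.toNNReal, ?_⟩
  intro T' S₀ S₂ A C₁ u₀ a₀ u a p π pK G x₀ y ρ₀ αv Ek t hT' hm₀ hu hG hGb hS₀ hS₀₂ hA hC₁ hLK hcl hbd hgrad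
    hρ₀ hagree hyr hαv ht htS ht1 hE1 hE2
  rw [ENNReal.coe_toNNReal hCt]
  -- ## the translated cut-off
  set ψ : (EuclideanSpace ℝ (Fin 3)) → ℝ := fun x => Ψ (x - y) with hψdef
  have hψ : ContDiff ℝ (⊤ : ℕ∞) ψ := hΨ.comp (contDiff_id.sub contDiff_const)
  have hψ0 : ∀ x, 0 ≤ ψ x := fun x => hΨ0 _
  have hψsupp : ∀ x, x ∉ ball y (r / 2) → x - y ∉ tsupport Ψ := by
    intro x hx hmem
    have h1 := hΨs hmem
    rw [mem_ball, dist_zero_right] at h1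
    rw [mem_ball, dist_eq_norm] at hx
    exact hx h1
  have hψK : ∀ x, x ∉ ball y (r / 2) → ψ x = 0 := fun x hx => hΨK _ (hψsupp x hx)
  have hψts : tsupport ψ ⊆ closedBall y (r / 2) := by
    refine closure_minimal (fun x hx => ?_) isClosed_closedBall
    by_contra h
    exact hx (hψK x fun h' => h (Metric.ball_subset_closedBall h'))
  have hψts' : tsupport ψ ⊆ ball y r := hψts.trans (closedBall_subset_ball (by linarith))
  have hψc : HasCompactSupport ψ := (isCompact_closedBall y (r / 2)).of_isClosed_subset (isClosed_tsupport ψ) hψts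
  have hgψ : ∀ x, gradient ψ x = gradient Ψ (x - y) := fun x => gradient_translate_sub Ψ y x
  have hLψ : ∀ x, (Δ ψ) x = (Δ Ψ) (x - y) := fun x => laplacian_translate_sub Ψ y x
  have hψB : ∀ x, ‖ψ x‖ ≤ Cψ := fun x => hCψ _
  have hgB : ∀ x, ‖gradient ψ x‖ ≤ Cg := fun x => by rw [hgψ]; exact hCg _
  have hLB : ∀ x, ‖(Δ ψ) x‖ ≤ CL := fun x => by rw [hLψ]; exact hCL _
  have hgK : ∀ x, x ∉ ball y (r / 2) → gradient ψ x = 0 := fun x hx => by rw [hgψ]; exact hgΨK _ (hψsupp x hx)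
  have hLK' : ∀ x, x ∉ ball y (r / 2) → (Δ ψ) x = 0 := fun x hx => by rw [hLψ]; exact hLΨK _ (hψsupp x hx)
  -- ## abbreviations
  set S : ℝ := min T' S₀ with hSdef
  have hS : 0 < S := lt_min hT' hS₀
  have htT' : t ≤ T' := htS.trans (min_le_left _ _)
  have htS₀ : t ≤ S₀ := htS.trans (min_le_right _ _)
  have htS₂ : t ≤ S₂ := htS₀.trans hS₀₂
  have hIt : Ioo 0 t ⊆ Ioo 0 S := Ioo_subset_Ioo_right htS
  have hItT' : Ioo 0 t ⊆ Ioo 0 T' := Ioo_subset_Ioo_right htT'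
  have hItS₂ : Ioo 0 t ⊆ Ioo 0 S₂ := Ioo_subset_Ioo_right htS₂
  have hEkt : (Ek : ℝ≥0∞) ≠ ⊤ := ENNReal.coe_ne_top
  -- ## the sliced inequality from the initial time
  have hC3 := ae_perturbed_energy_slice hT' hm₀ hu hG hGb hS₀ hS₀₂ hA hC₁ hLK hcl hbd hgrad hρ₀ hagree
    hψ (hψts'.trans hyr) hψ0
  -- ## integrability of the flux densities
  obtain ⟨-, hR₁I, hR₂I, hR₃I, hR₄I⟩ := flux_pieces_integrableOn hT' hu hS₀ hS₀₂ hA hC₁ hLK hcl hbd hgrad hψ hψc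
  -- ## measurability on the strip `(0,t) × ℝ³`
  have hstripm : MeasurableSet (Ioo 0 t ×ˢ (univ : Set (EuclideanSpace ℝ (Fin 3)))) := measurableSet_Ioo.prod MeasurableSet.univ
  have hum : AEStronglyMeasurable (uncurry u) (volume.restrict (Ioo 0 t ×ˢ (univ : Set (EuclideanSpace ℝ (Fin 3))))) :=
    hu.aestronglyMeasurable.mono_measure (Measure.restrict_mono (Set.prod_mono hItT' Subset.rfl) le_rfl)
  have ham : AEStronglyMeasurable (uncurry a) (volume.restrict (Ioo 0 t ×ˢ (univ : Set (EuclideanSpace ℝ (Fin 3))))) :=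
    (hcl.smooth_velocity.continuousOn.mono (Set.prod_mono hItS₂ Subset.rfl)).aestronglyMeasurable hstripm
  have hvm : AEStronglyMeasurable (fun z : ℝ × EuclideanSpace ℝ (Fin 3) => u z.1 z.2 - a z.1 z.2)
      (volume.restrict (Ioo 0 t ×ˢ (univ : Set (EuclideanSpace ℝ (Fin 3))))) := hum.sub ham
  have hvmB : AEStronglyMeasurable (fun z : ℝ × EuclideanSpace ℝ (Fin 3) => u z.1 z.2 - a z.1 z.2)
      (volume.restrict (Ioo 0 t ×ˢ ball y r)) :=
    hvm.mono_measure (Measure.restrict_mono (Set.prod_mono Subset.rfl (subset_univ _)) le_rfl)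
  -- ## the basic integrals on `(0,t) × B_r(y)`: energy, cube, weighted energy
  have hVt : ∫⁻ z in Ioo 0 t ×ˢ ball y r, ‖u z.1 z.2 - a z.1 z.2‖ₑ ^ 2 ≤ Ek * ENNReal.ofReal t := by
    have h := lintegral_prod_le_of_ae_slice_le measurableSet_ball (f := fun z => ‖u z.1 z.2 - a z.1 z.2‖ₑ ^ 2)
      (hvmB.aemeasurable.enorm.pow_const _) measurable_const (fun _ => ENNReal.one_ne_top) (w := fun _ => 1) hE1
    simp only [one_mul, lintegral_const, Measure.restrict_apply_univ, Real.volume_Ioo, sub_zero, one_mul] at h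
    exact h
  have hWt : ∫⁻ z in Ioo 0 t ×ˢ ball y r, ENNReal.ofReal (z.1 ^ (-(1 / 2 : ℝ))) * ‖u z.1 z.2 - a z.1 z.2‖ₑ ^ 2 ≤
      Ek * ENNReal.ofReal (2 * Real.sqrt t) := by
    have h := lintegral_prod_le_of_ae_slice_le measurableSet_ball (f := fun z => ‖u z.1 z.2 - a z.1 z.2‖ₑ ^ 2)
      (hvmB.aemeasurable.enorm.pow_const _) ((measurable_id.pow_const _).ennreal_ofReal)
      (fun _ => ENNReal.ofReal_ne_top) (w := fun s => ENNReal.ofReal (s ^ (-(1 / 2 : ℝ)))) hE1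
    rw [setLIntegral_Ioo_rpow_neg_half' ht] at h
    exact h
  -- the weak gradient of `v` on the cylinder and the cube
  set Ω : Opens (EuclideanSpace ℝ (Fin 3)) := ⟨ball y r, isOpen_ball⟩ with hΩ
  have hQT : (timeCylinder Ω 0 t : Opens (ℝ × EuclideanSpace ℝ (Fin 3))) ≤
      slab (EuclideanSpace ℝ (Fin 3)) (Ioo 0 T') isOpen_Ioo := fun z hz => mem_slab.2 (hItT' hz.1)
  have hQS : ((timeCylinder Ω 0 t : Opens (ℝ × EuclideanSpace ℝ (Fin 3))) : Set (ℝ × EuclideanSpace ℝ (Fin 3))) ⊆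
      Ioo 0 S₂ ×ˢ (univ : Set (EuclideanSpace ℝ (Fin 3))) := fun z hz => ⟨hItS₂ hz.1, mem_univ _⟩
  have hvgrad : HasWeakSpatialGradientOn (timeCylinder Ω 0 t) (fun s x => u s x - a s x)
      (fun s x => G s x - fderiv ℝ (a s) x) := hasWeakSpatialGradientOn_sub_flow hG hcl hQT hQS
  have hKt : ∫⁻ z in Ioo 0 t ×ˢ ball y r, ‖u z.1 z.2 - a z.1 z.2‖ₑ ^ (3 : ℕ) ≤
      Kc * (Ek : ℝ≥0∞) ^ (3 / 2 : ℝ) * (ENNReal.ofReal t + ENNReal.ofReal (t ^ (1 / 4 : ℝ))) :=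
    hKc (fun s x => u s x - a s x) (fun s x => G s x - fderiv ℝ (a s) x) t Ek t y hvgrad hE1 hE2 ht le_rfl
  -- ## the good slices and the slice pressure bound
  have hfin : ∫⁻ z in Ioo 0 t ×ˢ ball y (2 * (r / 2)),
      ENNReal.ofReal (frobeniusNormSq (G z.1 z.2 - fderiv ℝ (a z.1) z.2)) < ⊤ := by
    rw [show 2 * (r / 2) = r by ring]
    exact hE2.trans_lt ENNReal.coe_lt_top
  obtain ⟨Ae, hAet, hgood⟩ := ae_good_slice_pair hu hG hS₀₂ hLK hcl hbd y hρ0 htS hfin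
  have hαv' : ∀ᵐ τ ∂(volume.restrict (Ioo 0 t)), ∀ z : EuclideanSpace ℝ (Fin 3),
      ∫⁻ x in ball z 1, ‖a τ x - u τ x‖ₑ ^ 2 ≤ αv := by
    filter_upwards [ae_restrict_of_ae_restrict_of_subset hIt hαv] with τ hτ z
    refine le_of_eq_of_le (lintegral_congr fun x => ?_) (hτ z)
    rw [← enorm_neg, neg_sub]
  have h2r : 2 * (r / 2) = r := by ring
  -- the slice bound (for a.e. `τ ∈ (0,t)`)
  have hslice : ∀ᵐ τ ∂(volume.restrict (Ioo 0 t)),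
      ‖∫ x, (p τ x - pK τ x) * ⟪u τ x - a τ x, gradient ψ x⟫‖ₑ ≤
        (Csl : ℝ≥0∞) * (ENNReal.ofReal (2 * A) * Ek + (∫⁻ x in ball y r, ‖u τ x - a τ x‖ₑ ^ (3 : ℕ)) +
          (ENNReal.ofReal (2 * A) * (αv : ℝ≥0∞) ^ (1 / 2 : ℝ) + τt * αv) * (Ek : ℝ≥0∞) ^ (1 / 2 : ℝ)) := by
    have hgψm : AEStronglyMeasurable (fun x => gradient ψ x) volume := by
      have hc : Continuous fun x => gradient ψ x := by
        have e : (fun x => gradient ψ x) = fun x => gradient Ψ (x - y) := funext hgψ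
        rw [e]; exact hgΨcont.comp (continuous_id.sub continuous_const)
      exact hc.aestronglyMeasurable
    filter_upwards [hgood, hE1, hαv', ae_restrict_mem measurableSet_Ioo] with τ hg hEτ hατ hτI
    obtain ⟨ham', hum', hA₁, hA₂, hca, hcu, h6, hrep₁, hrep₂, hF₁, hF₂, hdiv⟩ := hg
    obtain ⟨κ₁, hκ₁⟩ := hrep₁
    obtain ⟨κ₂, hκ₂⟩ := hrep₂
    -- the pairing in the form of the slice lemma
    have hform : ∫ x, (p τ x - pK τ x) * ⟪u τ x - a τ x, gradient ψ x⟫ =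
        ∫ x, (pK τ x - p τ x) * ⟪a τ x - u τ x, gradient ψ x⟫ := by
      refine integral_congr_ae (Eventually.of_forall fun x => ?_)
      show (p τ x - pK τ x) * ⟪u τ x - a τ x, gradient ψ x⟫ = (pK τ x - p τ x) * ⟪a τ x - u τ x, gradient ψ x⟫
      have e : a τ x - u τ x = -(u τ x - a τ x) := by abel
      rw [e, inner_neg_left]; ring
    rw [hform]
    have hτS₂ : τ ∈ Ioo (0 : ℝ) S₂ := hItS₂ hτI
    have hm2A : (0 : ℝ) ≤ 2 * A := by positivity
    have hm₃ : ∀ᵐ x ∂(volume : Measure (EuclideanSpace ℝ (Fin 3))), ‖a τ x‖ ≤ 2 * A :=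
      Eventually.of_forall fun x => hbd τ hτS₂ x
    have hε₄ : eLpNorm (fun x => a τ x - a τ x) 3 volume ≤ ENNReal.ofReal 0 := by simp
    have hψtest : FunctionSpaces.IsTestFunctionOn (⊤ : Opens (EuclideanSpace ℝ (Fin 3))) ψ :=
      ⟨hψ, hψc, subset_univ _⟩
    have hres := hCsl hgψm hgB hgK ham' hum' ham' hAet hA₁ hA₂ hca hcu hm2A hm₃ le_rfl hε₄ h6 hκ₁ hκ₂ hF₁ hF₂
      (hdiv ψ hψtest)
    refine hres.trans ?_
    -- the slice quantities in terms of `E_k`, `α_v`, the cube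
    have hneg : ∀ x, ‖a τ x - u τ x‖ₑ = ‖u τ x - a τ x‖ₑ := fun x => by rw [← enorm_neg, neg_sub]
    have hEτ' : ∫⁻ x in ball y (2 * (r / 2)), ‖a τ x - u τ x‖ₑ ^ 2 ≤ Ek := by
      rw [h2r]; simp_rw [hneg]; exact hEτ
    have hKτ' : ∫⁻ x in ball y (2 * (r / 2)), ‖a τ x - u τ x‖ₑ ^ (3 : ℕ) = ∫⁻ x in ball y r, ‖u τ x - a τ x‖ₑ ^ (3 : ℕ) := by
      rw [h2r]; simp_rw [hneg]
    have hα2 : (⨆ z : EuclideanSpace ℝ (Fin 3), ∫⁻ x in ball z 1, ‖a τ x - u τ x‖ₑ ^ 2) ≤ αv := iSup_le hατ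
    have hTW : ∫⁻ x in (ball y (2 * (r / 2)))ᶜ, ‖a τ x - u τ x‖ₑ ^ 2 * ENNReal.ofReal ((‖x - y‖ ^ 4)⁻¹) ≤ τt * αv := by
      have hWr : ∀ z : EuclideanSpace ℝ (Fin 3), ∫⁻ x in ball z (r / 2), ‖a τ x - u τ x‖ₑ ^ 2 ≤ αv := fun z =>
        (lintegral_mono_set (ball_subset_ball hρ1)).trans (hατ z)
      have h := hKtail (fun x => ‖a τ x - u τ x‖ₑ ^ 2) ((ham'.sub hum').enorm.pow_const 2) αv hWr y (2 * (r / 2)) le_rfl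
      rw [show 2 * (r / 2) - r / 2 = r - r / 2 by ring] at h
      exact h
    have hEk12 : (∫⁻ x in ball y (2 * (r / 2)), ‖a τ x - u τ x‖ₑ ^ 2) ^ (1 / 2 : ℝ) ≤ (Ek : ℝ≥0∞) ^ (1 / 2 : ℝ) :=
      ENNReal.rpow_le_rpow hEτ' (by norm_num)
    have hα12 : (⨆ z : EuclideanSpace ℝ (Fin 3), ∫⁻ x in ball z 1, ‖a τ x - u τ x‖ₑ ^ 2) ^ (1 / 2 : ℝ) ≤ (αv : ℝ≥0∞) ^ (1 / 2 : ℝ) :=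
      ENNReal.rpow_le_rpow hα2 (by norm_num)
    simp only [ENNReal.ofReal_zero, zero_mul, add_zero]
    rw [hKτ']
    gcongr
  -- ## the good time slices `s`: the sliced inequality and the splitting of the flux
  have hC3' := ae_restrict_of_ae_restrict_of_subset hIt hC3
  filter_upwards [hC3', ae_restrict_mem measurableSet_Ioo] with s hs hsI
  refine hs.trans ?_
  have hsm : Ioo 0 s ×ˢ (univ : Set (EuclideanSpace ℝ (Fin 3))) ⊆ Ioo 0 S ×ˢ (univ : Set (EuclideanSpace ℝ (Fin 3))) :=
    Set.prod_mono (Ioo_subset_Ioo_right (hsI.2.le.trans htS)) Subset.rfl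
  have hst : Ioo 0 s ×ˢ (univ : Set (EuclideanSpace ℝ (Fin 3))) ⊆ Ioo 0 t ×ˢ (univ : Set (EuclideanSpace ℝ (Fin 3))) :=
    Set.prod_mono (Ioo_subset_Ioo_right hsI.2.le) Subset.rfl
  set Qs : Set (ℝ × EuclideanSpace ℝ (Fin 3)) := Ioo 0 s ×ˢ (univ : Set (EuclideanSpace ℝ (Fin 3))) with hQs
  have i₁ : IntegrableOn (fun z : ℝ × EuclideanSpace ℝ (Fin 3) => ‖u z.1 z.2 - a z.1 z.2‖ ^ 2 * (Δ ψ) z.2) Qs volume :=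
    hR₁I.mono_set hsm
  have i₂ : IntegrableOn (fun z : ℝ × EuclideanSpace ℝ (Fin 3) => ‖u z.1 z.2 - a z.1 z.2‖ ^ 2 * ⟪u z.1 z.2, gradient ψ z.2⟫) Qs volume :=
    hR₂I.mono_set hsm
  have i₃ : IntegrableOn (fun z : ℝ × EuclideanSpace ℝ (Fin 3) => (p z.1 z.2 - pK z.1 z.2) * ⟪u z.1 z.2 - a z.1 z.2, gradient ψ z.2⟫) Qs volume :=
    hR₃I.mono_set hsm
  have i₄ : IntegrableOn (fun z : ℝ × EuclideanSpace ℝ (Fin 3) =>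
      ψ z.2 * ⟪fderiv ℝ (a z.1) z.2 (u z.1 z.2 - a z.1 z.2), u z.1 z.2 - a z.1 z.2⟫) Qs volume :=
    hR₄I.mono_set hsm
  have hsplit : ∫ z in Qs, (‖u z.1 z.2 - a z.1 z.2‖ ^ 2 * (Δ ψ) z.2 +
        ‖u z.1 z.2 - a z.1 z.2‖ ^ 2 * ⟪u z.1 z.2, gradient ψ z.2⟫ +
        2 * ((p z.1 z.2 - pK z.1 z.2) * ⟪u z.1 z.2 - a z.1 z.2, gradient ψ z.2⟫) -
        2 * (ψ z.2 * ⟪fderiv ℝ (a z.1) z.2 (u z.1 z.2 - a z.1 z.2), u z.1 z.2 - a z.1 z.2⟫)) =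
      (∫ z in Qs, ‖u z.1 z.2 - a z.1 z.2‖ ^ 2 * (Δ ψ) z.2) +
        (∫ z in Qs, ‖u z.1 z.2 - a z.1 z.2‖ ^ 2 * ⟪u z.1 z.2, gradient ψ z.2⟫) +
        2 * (∫ z in Qs, (p z.1 z.2 - pK z.1 z.2) * ⟪u z.1 z.2 - a z.1 z.2, gradient ψ z.2⟫) -
        2 * ∫ z in Qs, ψ z.2 * ⟪fderiv ℝ (a z.1) z.2 (u z.1 z.2 - a z.1 z.2), u z.1 z.2 - a z.1 z.2⟫ := by
    have j12 : Integrable (fun z : ℝ × EuclideanSpace ℝ (Fin 3) => ‖u z.1 z.2 - a z.1 z.2‖ ^ 2 * (Δ ψ) z.2 +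
        ‖u z.1 z.2 - a z.1 z.2‖ ^ 2 * ⟪u z.1 z.2, gradient ψ z.2⟫) (volume.restrict Qs) := i₁.add i₂
    have j3 : Integrable (fun z : ℝ × EuclideanSpace ℝ (Fin 3) =>
        2 * ((p z.1 z.2 - pK z.1 z.2) * ⟪u z.1 z.2 - a z.1 z.2, gradient ψ z.2⟫)) (volume.restrict Qs) := i₃.const_mul 2
    have j123 : Integrable (fun z : ℝ × EuclideanSpace ℝ (Fin 3) => ‖u z.1 z.2 - a z.1 z.2‖ ^ 2 * (Δ ψ) z.2 +
        ‖u z.1 z.2 - a z.1 z.2‖ ^ 2 * ⟪u z.1 z.2, gradient ψ z.2⟫ +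
        2 * ((p z.1 z.2 - pK z.1 z.2) * ⟪u z.1 z.2 - a z.1 z.2, gradient ψ z.2⟫)) (volume.restrict Qs) := j12.add j3
    have j4 : Integrable (fun z : ℝ × EuclideanSpace ℝ (Fin 3) =>
        2 * (ψ z.2 * ⟪fderiv ℝ (a z.1) z.2 (u z.1 z.2 - a z.1 z.2), u z.1 z.2 - a z.1 z.2⟫)) (volume.restrict Qs) :=
      i₄.const_mul 2
    rw [integral_sub j123 j4, integral_add j12 j3, integral_add i₁ i₂, integral_const_mul, integral_const_mul]
  rw [hsplit]
  -- `ofReal (I₁ + I₂ + 2 I₃ - 2 I₄) ≤ ‖I₁‖ₑ + ‖I₂‖ₑ + 2‖I₃‖ₑ + 2‖I₄‖ₑ`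
  have hof : ∀ x : ℝ, ENNReal.ofReal x ≤ ‖x‖ₑ := fun x => by
    rw [Real.enorm_eq_ofReal_abs]; exact ENNReal.ofReal_le_ofReal (le_abs_self x)
  have henorm2 : ∀ x : ℝ, ‖2 * x‖ₑ = 2 * ‖x‖ₑ := fun x => by
    rw [enorm_mul, show ‖(2 : ℝ)‖ₑ = 2 from by rw [Real.enorm_eq_ofReal zero_le_two, ENNReal.ofReal_ofNat]]
  set I₁ : ℝ := ∫ z in Qs, ‖u z.1 z.2 - a z.1 z.2‖ ^ 2 * (Δ ψ) z.2 with hI₁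
  set I₂ : ℝ := ∫ z in Qs, ‖u z.1 z.2 - a z.1 z.2‖ ^ 2 * ⟪u z.1 z.2, gradient ψ z.2⟫ with hI₂
  set I₃ : ℝ := ∫ z in Qs, (p z.1 z.2 - pK z.1 z.2) * ⟪u z.1 z.2 - a z.1 z.2, gradient ψ z.2⟫ with hI₃
  set I₄ : ℝ := ∫ z in Qs, ψ z.2 * ⟪fderiv ℝ (a z.1) z.2 (u z.1 z.2 - a z.1 z.2), u z.1 z.2 - a z.1 z.2⟫ with hI₄
  have hsum : ENNReal.ofReal (I₁ + I₂ + 2 * I₃ - 2 * I₄) ≤ ‖I₁‖ₑ + ‖I₂‖ₑ + 2 * ‖I₃‖ₑ + 2 * ‖I₄‖ₑ := by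
    refine (hof _).trans ?_
    calc ‖I₁ + I₂ + 2 * I₃ - 2 * I₄‖ₑ ≤ ‖I₁ + I₂ + 2 * I₃‖ₑ + ‖2 * I₄‖ₑ := enorm_sub_le
      _ ≤ ‖I₁ + I₂‖ₑ + ‖2 * I₃‖ₑ + ‖2 * I₄‖ₑ := by gcongr; exact enorm_add_le _ _
      _ ≤ ‖I₁‖ₑ + ‖I₂‖ₑ + ‖2 * I₃‖ₑ + ‖2 * I₄‖ₑ := by gcongr; exact enorm_add_le _ _
      _ = ‖I₁‖ₑ + ‖I₂‖ₑ + 2 * ‖I₃‖ₑ + 2 * ‖I₄‖ₑ := by rw [henorm2, henorm2]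
  refine hsum.trans ?_
  -- ## from `Qs` to `(0,t) × B_r(y)` for densities vanishing off the ball
  have hball_t : ∀ {f : ℝ × EuclideanSpace ℝ (Fin 3) → ℝ≥0∞}, (∀ z, z.2 ∉ ball y r → f z = 0) →
      ∫⁻ z in Qs, f z ≤ ∫⁻ z in Ioo 0 t ×ˢ ball y r, f z := by
    intro f hf0
    have hset : MeasurableSet ((univ : Set ℝ) ×ˢ ball y r) := MeasurableSet.univ.prod measurableSet_ball
    have e : (fun z => f z) = ((univ : Set ℝ) ×ˢ ball y r).indicator f := by
      funext z
      by_cases hz : z.2 ∈ ball y r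
      · rw [indicator_of_mem (show z ∈ (univ : Set ℝ) ×ˢ ball y r from ⟨mem_univ _, hz⟩)]
      · rw [indicator_of_notMem (fun h => hz h.2), hf0 z hz]
    calc ∫⁻ z in Qs, f z = ∫⁻ z in Qs, ((univ : Set ℝ) ×ˢ ball y r).indicator f z := by rw [← e]
      _ = ∫⁻ z in ((univ : Set ℝ) ×ˢ ball y r) ∩ Qs, f z := by
          rw [lintegral_indicator hset, Measure.restrict_restrict hset]
      _ ≤ ∫⁻ z in Ioo 0 t ×ˢ ball y r, f z := lintegral_mono_set (fun z hz => ⟨(hst hz.2).1, hz.1.2⟩)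
  have hmem_t : ∀ᵐ z ∂(volume.restrict (Ioo 0 t ×ˢ ball y r)), z ∈ Ioo 0 t ×ˢ ball y r :=
    ae_restrict_mem (measurableSet_Ioo.prod measurableSet_ball)
  -- ## the term `|v|² Δψ`
  have hT₁ : ‖I₁‖ₑ ≤ CLₑ * (Ek * ENNReal.ofReal t) := by
    refine (enorm_integral_le_lintegral_enorm _).trans ?_
    refine (hball_t (f := fun z => ‖‖u z.1 z.2 - a z.1 z.2‖ ^ 2 * (Δ ψ) z.2‖ₑ) fun z hz => by
      rw [hLK' z.2 (fun h => hz (ball_subset_ball (by linarith) h)), mul_zero, enorm_zero]).trans ?_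
    calc ∫⁻ z in Ioo 0 t ×ˢ ball y r, ‖‖u z.1 z.2 - a z.1 z.2‖ ^ 2 * (Δ ψ) z.2‖ₑ
        ≤ ∫⁻ z in Ioo 0 t ×ˢ ball y r, CLₑ * ‖u z.1 z.2 - a z.1 z.2‖ₑ ^ 2 := by
          refine lintegral_mono fun z => ?_
          rw [enorm_mul, mul_comm, Real.enorm_eq_ofReal (sq_nonneg _), ENNReal.ofReal_pow (norm_nonneg _), ofReal_norm]
          gcongr
          rw [← ofReal_norm]
          exact ENNReal.ofReal_le_ofReal (hLB _)
      _ = CLₑ * ∫⁻ z in Ioo 0 t ×ˢ ball y r, ‖u z.1 z.2 - a z.1 z.2‖ₑ ^ 2 :=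
          lintegral_const_mul' _ _ ENNReal.ofReal_ne_top
      _ ≤ CLₑ * (Ek * ENNReal.ofReal t) := mul_le_mul' le_rfl hVt
  -- ## the term `|v|² u·∇ψ`
  have hT₂ : ‖I₂‖ₑ ≤ Cgₑ * (Kc * (Ek : ℝ≥0∞) ^ (3 / 2 : ℝ) * (ENNReal.ofReal t + ENNReal.ofReal (t ^ (1 / 4 : ℝ))) +
      ENNReal.ofReal (2 * A) * (Ek * ENNReal.ofReal t)) := by
    refine (enorm_integral_le_lintegral_enorm _).trans ?_
    refine (hball_t (f := fun z => ‖‖u z.1 z.2 - a z.1 z.2‖ ^ 2 * ⟪u z.1 z.2, gradient ψ z.2⟫‖ₑ) fun z hz => by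
      rw [hgK z.2 (fun h => hz (ball_subset_ball (by linarith) h)), inner_zero_right, mul_zero, enorm_zero]).trans ?_
    have hvm3 : AEMeasurable (fun z : ℝ × EuclideanSpace ℝ (Fin 3) => ‖u z.1 z.2 - a z.1 z.2‖ₑ ^ (3 : ℕ))
        (volume.restrict (Ioo 0 t ×ˢ ball y r)) := hvmB.aemeasurable.enorm.pow_const _
    have hvm2 : AEMeasurable (fun z : ℝ × EuclideanSpace ℝ (Fin 3) => ‖u z.1 z.2 - a z.1 z.2‖ₑ ^ 2)
        (volume.restrict (Ioo 0 t ×ˢ ball y r)) := hvmB.aemeasurable.enorm.pow_const _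
    calc ∫⁻ z in Ioo 0 t ×ˢ ball y r, ‖‖u z.1 z.2 - a z.1 z.2‖ ^ 2 * ⟪u z.1 z.2, gradient ψ z.2⟫‖ₑ
        ≤ ∫⁻ z in Ioo 0 t ×ˢ ball y r, Cgₑ * (‖u z.1 z.2 - a z.1 z.2‖ₑ ^ (3 : ℕ) +
            ENNReal.ofReal (2 * A) * ‖u z.1 z.2 - a z.1 z.2‖ₑ ^ 2) := by
          refine lintegral_mono_ae (hmem_t.mono fun z hz => ?_)
          have hzS₂ : z.1 ∈ Ioo (0 : ℝ) S₂ := hItS₂ hz.1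
          have hu_le : ‖u z.1 z.2‖ₑ ≤ ‖u z.1 z.2 - a z.1 z.2‖ₑ + ENNReal.ofReal (2 * A) := by
            have e : u z.1 z.2 = (u z.1 z.2 - a z.1 z.2) + a z.1 z.2 := by abel
            calc ‖u z.1 z.2‖ₑ = ‖(u z.1 z.2 - a z.1 z.2) + a z.1 z.2‖ₑ := by rw [← e]
              _ ≤ ‖u z.1 z.2 - a z.1 z.2‖ₑ + ‖a z.1 z.2‖ₑ := enorm_add_le _ _
              _ ≤ ‖u z.1 z.2 - a z.1 z.2‖ₑ + ENNReal.ofReal (2 * A) := by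
                  gcongr; rw [← ofReal_norm]; exact ENNReal.ofReal_le_ofReal (hbd z.1 hzS₂ z.2)
          have hg_le : ‖gradient ψ z.2‖ₑ ≤ Cgₑ := by rw [← ofReal_norm]; exact ENNReal.ofReal_le_ofReal (hgB _)
          rw [enorm_mul, Real.enorm_eq_ofReal (sq_nonneg _), ENNReal.ofReal_pow (norm_nonneg _), ofReal_norm]
          calc ‖u z.1 z.2 - a z.1 z.2‖ₑ ^ 2 * ‖⟪u z.1 z.2, gradient ψ z.2⟫‖ₑ
              ≤ ‖u z.1 z.2 - a z.1 z.2‖ₑ ^ 2 * (‖u z.1 z.2‖ₑ * ‖gradient ψ z.2‖ₑ) := by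
                gcongr; exact enorm_inner_le_mul _ _
            _ ≤ ‖u z.1 z.2 - a z.1 z.2‖ₑ ^ 2 * ((‖u z.1 z.2 - a z.1 z.2‖ₑ + ENNReal.ofReal (2 * A)) * Cgₑ) := by
                gcongr
            _ = Cgₑ * (‖u z.1 z.2 - a z.1 z.2‖ₑ ^ (3 : ℕ) + ENNReal.ofReal (2 * A) * ‖u z.1 z.2 - a z.1 z.2‖ₑ ^ 2) := by
                ring
      _ = Cgₑ * ((∫⁻ z in Ioo 0 t ×ˢ ball y r, ‖u z.1 z.2 - a z.1 z.2‖ₑ ^ (3 : ℕ)) +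
            ENNReal.ofReal (2 * A) * ∫⁻ z in Ioo 0 t ×ˢ ball y r, ‖u z.1 z.2 - a z.1 z.2‖ₑ ^ 2) := by
          rw [lintegral_const_mul' _ _ ENNReal.ofReal_ne_top, lintegral_add_left' hvm3,
            lintegral_const_mul' _ _ ENNReal.ofReal_ne_top]
      _ ≤ Cgₑ * (Kc * (Ek : ℝ≥0∞) ^ (3 / 2 : ℝ) * (ENNReal.ofReal t + ENNReal.ofReal (t ^ (1 / 4 : ℝ))) +
            ENNReal.ofReal (2 * A) * (Ek * ENNReal.ofReal t)) := by
          gcongr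
  -- ## the term `ψ⟪Da v, v⟫`
  have hT₄ : ‖I₄‖ₑ ≤ Cψₑ * ENNReal.ofReal (C₁ * A) * (Ek * ENNReal.ofReal (2 * Real.sqrt t)) := by
    refine (enorm_integral_le_lintegral_enorm _).trans ?_
    refine (hball_t (f := fun z => ‖ψ z.2 * ⟪fderiv ℝ (a z.1) z.2 (u z.1 z.2 - a z.1 z.2), u z.1 z.2 - a z.1 z.2⟫‖ₑ)
      fun z hz => by rw [hψK z.2 (fun h => hz (ball_subset_ball (by linarith) h)), zero_mul, enorm_zero]).trans ?_
    calc ∫⁻ z in Ioo 0 t ×ˢ ball y r, ‖ψ z.2 * ⟪fderiv ℝ (a z.1) z.2 (u z.1 z.2 - a z.1 z.2), u z.1 z.2 - a z.1 z.2⟫‖ₑ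
        ≤ ∫⁻ z in Ioo 0 t ×ˢ ball y r, Cψₑ * ENNReal.ofReal (C₁ * A) *
            (ENNReal.ofReal (z.1 ^ (-(1 / 2 : ℝ))) * ‖u z.1 z.2 - a z.1 z.2‖ₑ ^ 2) := by
          refine lintegral_mono_ae (hmem_t.mono fun z hz => ?_)
          have hz0 : 0 < z.1 := hz.1.1
          have hzS₀ : z.1 ∈ Ioo (0 : ℝ) S₀ := ⟨hz0, hz.1.2.trans_le htS₀⟩
          have hDa : ‖fderiv ℝ (a z.1) z.2‖ ≤ C₁ * A * z.1 ^ (-(1 / 2 : ℝ)) := by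
            have h := hgrad z.1 hzS₀ z.2
            have hsq : 0 < Real.sqrt z.1 := Real.sqrt_pos.2 hz0
            rw [Real.rpow_neg hz0.le, ← Real.sqrt_eq_rpow, ← div_eq_mul_inv, le_div_iff₀ hsq, mul_comm]
            exact h
          have hψ_le : ‖ψ z.2‖ₑ ≤ Cψₑ := by rw [← ofReal_norm]; exact ENNReal.ofReal_le_ofReal (hψB _)
          have hDa' : ‖fderiv ℝ (a z.1) z.2‖ₑ ≤ ENNReal.ofReal (C₁ * A) * ENNReal.ofReal (z.1 ^ (-(1 / 2 : ℝ))) := by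
            rw [← ofReal_norm, ← ENNReal.ofReal_mul (by positivity)]
            exact ENNReal.ofReal_le_ofReal hDa
          rw [enorm_mul]
          calc ‖ψ z.2‖ₑ * ‖⟪fderiv ℝ (a z.1) z.2 (u z.1 z.2 - a z.1 z.2), u z.1 z.2 - a z.1 z.2⟫‖ₑ
              ≤ Cψₑ * (‖fderiv ℝ (a z.1) z.2 (u z.1 z.2 - a z.1 z.2)‖ₑ * ‖u z.1 z.2 - a z.1 z.2‖ₑ) :=
                mul_le_mul' hψ_le (enorm_inner_le_mul _ _)
            _ ≤ Cψₑ * ((‖fderiv ℝ (a z.1) z.2‖ₑ * ‖u z.1 z.2 - a z.1 z.2‖ₑ) * ‖u z.1 z.2 - a z.1 z.2‖ₑ) := by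
                gcongr
                rw [← ofReal_norm, ← ofReal_norm, ← ofReal_norm, ← ENNReal.ofReal_mul (norm_nonneg _)]
                exact ENNReal.ofReal_le_ofReal (ContinuousLinearMap.le_opNorm _ _)
            _ ≤ Cψₑ * ((ENNReal.ofReal (C₁ * A) * ENNReal.ofReal (z.1 ^ (-(1 / 2 : ℝ))) * ‖u z.1 z.2 - a z.1 z.2‖ₑ) *
                  ‖u z.1 z.2 - a z.1 z.2‖ₑ) := by gcongr
            _ = Cψₑ * ENNReal.ofReal (C₁ * A) * (ENNReal.ofReal (z.1 ^ (-(1 / 2 : ℝ))) * ‖u z.1 z.2 - a z.1 z.2‖ₑ ^ 2) := by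
                ring
      _ = Cψₑ * ENNReal.ofReal (C₁ * A) *
            ∫⁻ z in Ioo 0 t ×ˢ ball y r, ENNReal.ofReal (z.1 ^ (-(1 / 2 : ℝ))) * ‖u z.1 z.2 - a z.1 z.2‖ₑ ^ 2 :=
          lintegral_const_mul' _ _ (ENNReal.mul_ne_top ENNReal.ofReal_ne_top ENNReal.ofReal_ne_top)
      _ ≤ Cψₑ * ENNReal.ofReal (C₁ * A) * (Ek * ENNReal.ofReal (2 * Real.sqrt t)) := mul_le_mul' le_rfl hWt
  -- ## the pressure term: Fubini in time and the slice bound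
  have hT₃ : ‖I₃‖ₑ ≤ (Csl : ℝ≥0∞) * (ENNReal.ofReal (2 * A) * Ek * ENNReal.ofReal t +
      Kc * (Ek : ℝ≥0∞) ^ (3 / 2 : ℝ) * (ENNReal.ofReal t + ENNReal.ofReal (t ^ (1 / 4 : ℝ))) +
      (ENNReal.ofReal (2 * A) * (αv : ℝ≥0∞) ^ (1 / 2 : ℝ) + τt * αv) * (Ek : ℝ≥0∞) ^ (1 / 2 : ℝ) * ENNReal.ofReal t) := by
    -- Fubini
    have hprods : (volume.restrict Qs : Measure (ℝ × EuclideanSpace ℝ (Fin 3))) =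
        ((volume : Measure ℝ).restrict (Ioo 0 s)).prod (volume : Measure (EuclideanSpace ℝ (Fin 3))) := by
      rw [hQs, Measure.volume_eq_prod, Measure.restrict_prod_eq_prod_univ]
    have i₃' : Integrable (fun z : ℝ × EuclideanSpace ℝ (Fin 3) => (p z.1 z.2 - pK z.1 z.2) * ⟪u z.1 z.2 - a z.1 z.2, gradient ψ z.2⟫)
        (((volume : Measure ℝ).restrict (Ioo 0 s)).prod (volume : Measure (EuclideanSpace ℝ (Fin 3)))) := by
      rw [← hprods]; exact i₃
    have hI₃eq : I₃ = ∫ τ in Ioo 0 s, ∫ x, (p τ x - pK τ x) * ⟪u τ x - a τ x, gradient ψ x⟫ := by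
      rw [hI₃, show (∫ z in Qs, (p z.1 z.2 - pK z.1 z.2) * ⟪u z.1 z.2 - a z.1 z.2, gradient ψ z.2⟫) =
        ∫ z, (p z.1 z.2 - pK z.1 z.2) * ⟪u z.1 z.2 - a z.1 z.2, gradient ψ z.2⟫ ∂(volume.restrict Qs) from rfl,
        hprods, integral_prod _ i₃']
    rw [hI₃eq]
    refine (enorm_integral_le_lintegral_enorm _).trans ?_
    -- the slice bound, integrated over `(0,s) ⊆ (0,t)`
    have hvm3 : AEMeasurable (fun z : ℝ × EuclideanSpace ℝ (Fin 3) => ‖u z.1 z.2 - a z.1 z.2‖ₑ ^ (3 : ℕ))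
        (volume.restrict (Ioo 0 t ×ˢ ball y r)) := hvmB.aemeasurable.enorm.pow_const _
    have hprodt : (volume.restrict (Ioo 0 t ×ˢ ball y r) : Measure (ℝ × EuclideanSpace ℝ (Fin 3))) =
        (volume.restrict (Ioo 0 t)).prod (volume.restrict (ball y r)) := by
      rw [Measure.volume_eq_prod, Measure.prod_restrict]
    have hvm3' : AEMeasurable (fun z : ℝ × EuclideanSpace ℝ (Fin 3) => ‖u z.1 z.2 - a z.1 z.2‖ₑ ^ (3 : ℕ))
        ((volume.restrict (Ioo 0 t)).prod (volume.restrict (ball y r))) := by rwa [← hprodt]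
    have hKcube : ∫⁻ τ in Ioo 0 t, ∫⁻ x in ball y r, ‖u τ x - a τ x‖ₑ ^ (3 : ℕ) =
        ∫⁻ z in Ioo 0 t ×ˢ ball y r, ‖u z.1 z.2 - a z.1 z.2‖ₑ ^ (3 : ℕ) := by
      rw [hprodt, lintegral_prod _ hvm3']
    calc ∫⁻ τ in Ioo 0 s, ‖∫ x, (p τ x - pK τ x) * ⟪u τ x - a τ x, gradient ψ x⟫‖ₑ
        ≤ ∫⁻ τ in Ioo 0 t, ‖∫ x, (p τ x - pK τ x) * ⟪u τ x - a τ x, gradient ψ x⟫‖ₑ :=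
          lintegral_mono_set (Ioo_subset_Ioo_right hsI.2.le)
      _ ≤ ∫⁻ τ in Ioo 0 t, (Csl : ℝ≥0∞) * (ENNReal.ofReal (2 * A) * Ek + (∫⁻ x in ball y r, ‖u τ x - a τ x‖ₑ ^ (3 : ℕ)) +
          (ENNReal.ofReal (2 * A) * (αv : ℝ≥0∞) ^ (1 / 2 : ℝ) + τt * αv) * (Ek : ℝ≥0∞) ^ (1 / 2 : ℝ)) :=
          lintegral_mono_ae hslice
      _ = (Csl : ℝ≥0∞) * ((ENNReal.ofReal (2 * A) * Ek) * volume (Ioo (0 : ℝ) t) +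
          (∫⁻ τ in Ioo 0 t, ∫⁻ x in ball y r, ‖u τ x - a τ x‖ₑ ^ (3 : ℕ)) +
          ((ENNReal.ofReal (2 * A) * (αv : ℝ≥0∞) ^ (1 / 2 : ℝ) + τt * αv) * (Ek : ℝ≥0∞) ^ (1 / 2 : ℝ)) * volume (Ioo (0 : ℝ) t)) := by
          rw [lintegral_const_mul' _ _ ENNReal.coe_ne_top, lintegral_add_right' _ aemeasurable_const,
            lintegral_add_left' aemeasurable_const, lintegral_const, lintegral_const, Measure.restrict_apply_univ]
      _ ≤ _ := by
          rw [Real.volume_Ioo, sub_zero, hKcube]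
          exact mul_le_mul' le_rfl (add_le_add (add_le_add le_rfl hKt) le_rfl)
  -- ## assembling
  set tₑ : ℝ≥0∞ := ENNReal.ofReal t with htₑ
  set t4 : ℝ≥0∞ := ENNReal.ofReal (t ^ (1 / 4 : ℝ)) with ht4
  set st : ℝ≥0∞ := ENNReal.ofReal (Real.sqrt t) with hst'
  set Aₑ : ℝ≥0∞ := ENNReal.ofReal A with hAₑ
  set Ekₑ : ℝ≥0∞ := (Ek : ℝ≥0∞) with hEkₑ
  set αₑ : ℝ≥0∞ := (αv : ℝ≥0∞) with hαₑ
  have h2A : ENNReal.ofReal (2 * A) = 2 * Aₑ := by rw [hAₑ, ENNReal.ofReal_mul zero_le_two, ENNReal.ofReal_ofNat]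
  have h2st : ENNReal.ofReal (2 * Real.sqrt t) = 2 * st := by rw [hst', ENNReal.ofReal_mul zero_le_two, ENNReal.ofReal_ofNat]
  have hC₁A : ENNReal.ofReal (C₁ * A) ≤ 1 + Aₑ + ENNReal.ofReal (C₁ * A) := le_add_self
  -- `t ≤ √t`, `t ≤ t^{1/4}` for `t ≤ 1`
  have ht_st : tₑ ≤ st := by
    refine ENNReal.ofReal_le_ofReal ?_
    calc t = Real.sqrt t * Real.sqrt t := (Real.mul_self_sqrt ht.le).symm
      _ ≤ Real.sqrt t * 1 := by
          refine mul_le_mul_of_nonneg_left ?_ (Real.sqrt_nonneg _)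
          rw [Real.sqrt_le_one]; exact ht1
      _ = Real.sqrt t := mul_one _
  have ht_t4 : tₑ ≤ t4 := by
    refine ENNReal.ofReal_le_ofReal ?_
    calc t = t ^ (1 : ℝ) := (Real.rpow_one t).symm
      _ ≤ t ^ (1 / 4 : ℝ) := Real.rpow_le_rpow_of_exponent_ge ht ht1 (by norm_num)
  -- the three groups
  set X : ℝ≥0∞ := (1 + Aₑ + ENNReal.ofReal (C₁ * A)) * st * Ekₑ with hX
  set Y : ℝ≥0∞ := t4 * Ekₑ ^ (3 / 2 : ℝ) with hY
  set Z : ℝ≥0∞ := (Aₑ * αₑ ^ (1 / 2 : ℝ) + αₑ) * tₑ * Ekₑ ^ (1 / 2 : ℝ) with hZ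
  have hone : (1 : ℝ≥0∞) ≤ 1 + Aₑ + ENNReal.ofReal (C₁ * A) := le_add_right (le_add_right le_rfl)
  have hA1 : Aₑ ≤ 1 + Aₑ + ENNReal.ofReal (C₁ * A) := le_add_right le_add_self
  -- `E t ≤ X`, `A E t ≤ X`, `(C₁A) E √t ≤ X`, `E^{3/2}(t + t^{1/4}) ≤ 2Y`
  have hEt_X : Ekₑ * tₑ ≤ X := by
    calc Ekₑ * tₑ ≤ Ekₑ * st := by gcongr
      _ = 1 * st * Ekₑ := by ring
      _ ≤ X := by simp only [hX]; gcongr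
  have hAEt_X : Aₑ * (Ekₑ * tₑ) ≤ X := by
    calc Aₑ * (Ekₑ * tₑ) ≤ Aₑ * (Ekₑ * st) := by gcongr
      _ = Aₑ * st * Ekₑ := by ring
      _ ≤ X := by simp only [hX]; gcongr
  have hCEst_X : ENNReal.ofReal (C₁ * A) * (Ekₑ * st) ≤ X := by
    calc ENNReal.ofReal (C₁ * A) * (Ekₑ * st) = ENNReal.ofReal (C₁ * A) * st * Ekₑ := by ring
      _ ≤ X := by simp only [hX]; gcongr
  have hY2 : Ekₑ ^ (3 / 2 : ℝ) * (tₑ + t4) ≤ 2 * Y := by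
    calc Ekₑ ^ (3 / 2 : ℝ) * (tₑ + t4) ≤ Ekₑ ^ (3 / 2 : ℝ) * (t4 + t4) := by gcongr
      _ = 2 * Y := by simp only [hY]; ring
  have hZ' : (ENNReal.ofReal (2 * A) * αₑ ^ (1 / 2 : ℝ) + τt * αₑ) * Ekₑ ^ (1 / 2 : ℝ) * tₑ ≤ (2 + τt) * Z := by
    rw [h2A]
    have hcoef : 2 * Aₑ * αₑ ^ (1 / 2 : ℝ) + τt * αₑ ≤ (2 + τt) * (Aₑ * αₑ ^ (1 / 2 : ℝ) + αₑ) := by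
      calc 2 * Aₑ * αₑ ^ (1 / 2 : ℝ) + τt * αₑ
          ≤ (2 * Aₑ * αₑ ^ (1 / 2 : ℝ) + τt * αₑ) + (2 * αₑ + τt * (Aₑ * αₑ ^ (1 / 2 : ℝ))) := le_self_add
        _ = (2 + τt) * (Aₑ * αₑ ^ (1 / 2 : ℝ) + αₑ) := by ring
    calc (2 * Aₑ * αₑ ^ (1 / 2 : ℝ) + τt * αₑ) * Ekₑ ^ (1 / 2 : ℝ) * tₑ
        ≤ ((2 + τt) * (Aₑ * αₑ ^ (1 / 2 : ℝ) + αₑ)) * Ekₑ ^ (1 / 2 : ℝ) * tₑ :=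
          mul_le_mul' (mul_le_mul' hcoef le_rfl) le_rfl
      _ = (2 + τt) * Z := by simp only [hZ]; ring
  -- the four terms against the groups
  have hB₁ : ‖I₁‖ₑ ≤ CLₑ * X := hT₁.trans (mul_le_mul' le_rfl hEt_X)
  have hB₂ : ‖I₂‖ₑ ≤ 2 * Cgₑ * X + 2 * Cgₑ * Kc * Y := by
    refine hT₂.trans ?_
    rw [h2A]
    calc Cgₑ * (Kc * Ekₑ ^ (3 / 2 : ℝ) * (tₑ + t4) + 2 * Aₑ * (Ekₑ * tₑ))
        = Cgₑ * Kc * (Ekₑ ^ (3 / 2 : ℝ) * (tₑ + t4)) + 2 * Cgₑ * (Aₑ * (Ekₑ * tₑ)) := by ring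
      _ ≤ Cgₑ * Kc * (2 * Y) + 2 * Cgₑ * X := add_le_add (mul_le_mul' le_rfl hY2) (mul_le_mul' le_rfl hAEt_X)
      _ = 2 * Cgₑ * X + 2 * Cgₑ * Kc * Y := by ring
  have hB₃ : 2 * ‖I₃‖ₑ ≤ 4 * (Csl : ℝ≥0∞) * X + 4 * (Csl : ℝ≥0∞) * Kc * Y + 2 * (Csl : ℝ≥0∞) * (2 + τt) * Z := by
    calc 2 * ‖I₃‖ₑ ≤ 2 * ((Csl : ℝ≥0∞) * (ENNReal.ofReal (2 * A) * Ekₑ * tₑ +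
          Kc * Ekₑ ^ (3 / 2 : ℝ) * (tₑ + t4) +
          (ENNReal.ofReal (2 * A) * αₑ ^ (1 / 2 : ℝ) + τt * αₑ) * Ekₑ ^ (1 / 2 : ℝ) * tₑ)) := mul_le_mul' le_rfl hT₃
      _ = 4 * (Csl : ℝ≥0∞) * (Aₑ * (Ekₑ * tₑ)) + 2 * (Csl : ℝ≥0∞) * Kc * (Ekₑ ^ (3 / 2 : ℝ) * (tₑ + t4)) +
          2 * (Csl : ℝ≥0∞) * ((ENNReal.ofReal (2 * A) * αₑ ^ (1 / 2 : ℝ) + τt * αₑ) * Ekₑ ^ (1 / 2 : ℝ) * tₑ) := by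
          rw [h2A]; ring
      _ ≤ 4 * (Csl : ℝ≥0∞) * X + 2 * (Csl : ℝ≥0∞) * Kc * (2 * Y) + 2 * (Csl : ℝ≥0∞) * ((2 + τt) * Z) :=
          add_le_add (add_le_add (mul_le_mul' le_rfl hAEt_X) (mul_le_mul' le_rfl hY2)) (mul_le_mul' le_rfl hZ')
      _ = 4 * (Csl : ℝ≥0∞) * X + 4 * (Csl : ℝ≥0∞) * Kc * Y + 2 * (Csl : ℝ≥0∞) * (2 + τt) * Z := by ring
  have hB₄ : 2 * ‖I₄‖ₑ ≤ 4 * Cψₑ * X := by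
    calc 2 * ‖I₄‖ₑ ≤ 2 * (Cψₑ * ENNReal.ofReal (C₁ * A) * (Ekₑ * ENNReal.ofReal (2 * Real.sqrt t))) := mul_le_mul' le_rfl hT₄
      _ = 4 * Cψₑ * (ENNReal.ofReal (C₁ * A) * (Ekₑ * st)) := by rw [h2st]; ring
      _ ≤ 4 * Cψₑ * X := mul_le_mul' le_rfl hCEst_X
  calc ‖I₁‖ₑ + ‖I₂‖ₑ + 2 * ‖I₃‖ₑ + 2 * ‖I₄‖ₑ
      ≤ CLₑ * X + (2 * Cgₑ * X + 2 * Cgₑ * Kc * Y) +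
          (4 * (Csl : ℝ≥0∞) * X + 4 * (Csl : ℝ≥0∞) * Kc * Y + 2 * (Csl : ℝ≥0∞) * (2 + τt) * Z) + 4 * Cψₑ * X :=
        add_le_add (add_le_add (add_le_add hB₁ hB₂) hB₃) hB₄
    _ = cX * X + cY * Y + cZ * Z := by simp only [hcX, hcY, hcZ]; ring
    _ ≤ C * X + C * Y + C * Z := by
        refine add_le_add (add_le_add (mul_le_mul' ?_ le_rfl) (mul_le_mul' ?_ le_rfl)) (mul_le_mul' ?_ le_rfl)
        · simp only [hC]; exact le_add_right (le_add_right le_rfl)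
        · simp only [hC]; exact le_add_right le_add_self
        · simp only [hC]; exact le_add_self
    _ = C * (X + Y + Z) := by ring

end JiaSverak2014

end Literature.Analysis.FluidPDE

end
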